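import Summits.QuantumFields.YangMills.Theorems.BalabanUVNodesN24K1R9ByNameSlot8Thm1AEInstPerKappaPrimeGuarded
import Summits.QuantumFields.YangMills.Theorems.BalabanUVNodesN05SubBP2DK2PerKappaSlotExistsOfBindersLettersPerDoorL
import Literature.MathematicalPhysics.QuantumFieldTheory.Balaban1983to89.Node00.Record12NumericsFamilyFiniteDim

/-!
# NODE N24 (B2) — THE K1-FACE N05 JUNCTION ON THE EDITION OF RECORD ζ-L (p673108): K1⁹ `StabilityBRunRowsAtRecordR13SepCoPHV` (stmt-QuantumFields-27364) BY ITS ROUTE NAME ON THE V21-G ∕ θᴳᶻ SLOT ROAD AT THE WITNESS SLOT OF RECORD `Slot8κ′`,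
# WITH NODE N05 READ THROUGH ζ-L (`…OfBindersLettersPerDoorL.exists_residB8_slot8κ'_of_bindersLettersPer_doorL`, the N05 discharge edition of record, director-ym №235∕№236) BY NAME — p672260's twin (ζ-L's `hLet` carries [4]'s (L4) insertion) — N05's `h05` family DISCHARGED into NODE N06's five binder
# predicates + N06's torus record data∕constants + the Hölder pair + [Balaban1985BackgroundPropagators]'s two Prop-5 letter families; nothing of N05's own remains displayed

TRACK A (YM-PLAN §2d, node N24 of 28 = binder B2), seat `pub-ymgap-dag-n24-c` (R134 s2; gen 13, CLAIM-64).  Key of record K1⁹ = stmt-QuantumFields-27364 (`--kind proof --supports 27364 --as helper`,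
Summits lane; count-neutral).  [B8] = [Balaban1985RegularSpaces]; [4] = [Balaban1985BackgroundPropagators]; [V] = [Balaban1989LargeFieldII]; [III] = [Balaban1988Convergent]; [I] = [Balaban1987RG1].

WHY (plan g87 `[YMPLAN-G87-N05-LOCATED4]` (R3′) → `[…10PRIME-2]` door recipe → dag-n05-c g18 OFFER «ζ» ∕ my «WANTED — GO» I.43089).  The composite node N24 knits each child at the K1 face
in the child's OWN served currency.  For N05 on the witness slot of record `Slot8κ′` (p658298) the served currency is now ζ (p670259, over n05-d's ε p669550): the Prop-6 door by dag-n05-e's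
PROVED `prop6Printed_zdCubP_γ_holds_record_dvd`, every free scalar chosen, every (8′)∕(9′)∕free-constant inequality proved — leaving exactly NODE N06's compact binder predicates at print-class
periodic members, N06's genuine torus record data and binder constants, the Hölder pair, and [4]'s two letter families.  THIS FILE composes p658298 §2 with ζ-L (p672260 did it with ζ p670259; the discharge of record is booked on ζ-L p673108, whose `hLet` binder carries one more clause — so the K1 face must display ζ-L's binders to be the junction OF RECORD): per door tuple the z-witness's
Stage-3 view θZ₃ := `(theta13OfThm1CCMWZ F 2 j γ … (Efl F) (logz F)).toStage3Params` needs three facts, all discharged here by unfolding the family dictionary `stage3OfFamily F` (`𝔸 := ℂ`,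
`D := 4`, `L := F.L`): `FiniteDimensional ℝ θZ₃.𝔸` (`Node00.finiteDimensional_𝔸_stage3OfFamily F` — EDITION director-ym №262, FLAG №14 T0 (β): formerly `show FiniteDimensional ℝ ℂ`, re-key-neutral now), `2 ≤ θZ₃.D` (`show 2 ≤ 4`), `5 ≤ θZ₃.L` (`F.hL11`) — this seat's junction census of 19:15Z.

WHAT THIS FILE PROVES (1 theorem, 0 `def`, 0 `sorry`; standard axioms).  ★★★★ `N24_stabilityBRunRowsAtRecordR13SepCoPHV_byName_of_openStubsGridG_of_n05BindersLettersLSlot8KappaPrime_atGaussPinZ_of_runRowsCont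
(M₁ R : ℕ) (hM₁ : 1 ≤ M₁) (Efl logz) (h1G3 h3A'G3 : V21-G's REGISTERED stub texts) (hN05 : per `F` and door tuple, ∃ ζ-L's data, ζ-L's displayed hypotheses at θZ₃ — VERBATIM) (h06 … h10, h09T) (h11N)
(h13) (hrowsR) : Summit.QuantumFields.YangMills.Theses.BalabanUVNodes.StabilityBRunRowsAtRecordR13SepCoPHV` := p658298 §2 with `h05 := fun F … => exists_residB8_slot8κ'_of_bindersLettersPer_doorL θZ₃ … M₁ R hM₁ ⟨ζ-L's data⟩`.
The NODE-O-sharp variant (`…_of_psFloorSurvCont`) and the θᴴᶻ twin (p658298 §1 base) are the same one-liner (not typed here: line budget).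

WHICH CHILD BLOCKS AT θᴳᶻ AFTER THIS FILE (= its hypotheses): K0⁷ V21-G stubs 1-G‴ ∧ 3ᴬ′-G‴ (REGISTERED 0∕2); **N05 → `hN05` = N06's five binders (`InvAtHIPer`, `GlobAtIPer`, `HolderAtIH2Per`, `SrcAtIPer`,
`SrcHolderAtIH2Per`) at print-class periodic members + N06's torus record data∕constants + Hölder pair + [4]'s letters `hLet` ∕ `SLetUB` (servers: N06, IR-N05-P5NS ∕ lit-balaban) + `1 ≤ M₁`**;
N06–N10 displayed; N11 `h11N`; N13 a.e. rows at θᴳᶻ; NODE O `hrowsR`.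

HONEST FRAMING.  Composition BY NAME (one `refine` + one `exact`); NO estimate; nothing of Bałaban's asserted; every family DISPLAYED as a hypothesis (CONDITIONAL, audit `proof.conditional`);
letters `Efl`, `logz` FREE; NOT a claim that θᴳᶻ is K1⁹'s witness; NO v10 ∕ V21-G stub proved or closed; N05 ∕ N06 ∕ N11 ∕ N13 NOT discharged; N24 COMPOSITE — no count moved (typed 28∕28 ·
discharged 5∕27 · A 5∕28); K0⁷ «V21-G 0∕2 (+2′)» ∕ K1⁹ stmt-QuantumFields-27364 (DECIDING; v10 0∕6) ∕ K3⁸ OPEN; FLAG №4 (N05) OPEN; one finite 𝕋⁴ programme at fixed ε, Bałaban AS PRINTED; R4 = the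
conditional finite-𝕋⁴ rung `BalabanLadder.UV` only — NOT continuum ∕ ℝ⁴ ∕ OS ∕ mass gap ∕ Clay: the Yang–Mills mass gap is NOT proved by any of this.  No `sorry`, `def`, `instance`, `notation`.
-/

noncomputable section

open scoped Matrix.Norms.L2Operator BigOperators
open Filter Topology MeasureTheory

namespace Summit.QuantumFields.YangMills.BalabanUVNodes.N24K1FaceN05JunctionLSlot8KappaPrimeAtGaussPinZ

open Literature.MathematicalPhysics.QuantumFieldTheory.Balaban1983to89
open Literature.MathematicalPhysics.QuantumFieldTheory.Balaban1983to89.Node00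
open DagBinding T4Continuum T4DatumAssembly FlowStepRuns AveragingRT
open FlowStep (HBeta RGEqH prefixOf prefixOf_apply BetaLowerH BetaUpperH Box mem_box clampPrefix Y)
open Literature.MathematicalPhysics.QuantumFieldTheory.Balaban1983to89.B8LeafModelZd (ZdIdx)
open Literature.MathematicalPhysics.QuantumFieldTheory.Balaban1983to89.B8TowerBondsPrinted (towerBondsP)
open Literature.MathematicalPhysics.QuantumFieldTheory.Balaban1983to89.B9SupplySockB9P3ZdSrcPer (SrcAtIPer SrcHolderAtIH2Per)
open Literature.MathematicalPhysics.QuantumFieldTheory.Balaban1983to89.B9SupplySockB9P3ZdLetters (OpsZd)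
open Literature.MathematicalPhysics.QuantumFieldTheory.Balaban1983to89.B9Eq327GreenZdHermPer (InvAtHIPer)
open Literature.MathematicalPhysics.QuantumFieldTheory.Balaban1983to89.B9SupplySockB9P3ZdPer (GlobAtIPer)
open Literature.MathematicalPhysics.QuantumFieldTheory.Balaban1983to89.B9SupplySockB9P3ZdH2Per (HolderAtIH2Per)
open Literature.MathematicalPhysics.QuantumFieldTheory.Balaban1983to89.B9SupplySockB9P3ZdAllLettersZdPer (opsAllZdPer)
open T4TermwiseTorus (IsPeriodic)
open MatrixLog B7Prop2Explicit B7Prop1Local B7Eq92Concrete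
open B8Ineq132 (InAk covDerivFwd)
open B8Eq119TwistedAxial (bgT)
open B8Eq140Level (SideTouches)
open B8Eq138LandauZd (covLap QT)
open B7Eq78Linearization (zdBlocking QprimeIter)
open B8Eq1117Concrete (XSpace)
open B8Prop5ContractionKLevel (Bd2)
open B8LambdaSpaceKLevel (wt)
open Summit.QuantumFields.YangMills.Theorems.K0V19Defs (Prop8StepCoPAt AbsBetaBoxAtThm1WitnessCCMGenAt)
open Summit.QuantumFields.YangMills.Theorems.BalabanUVNodesN11GaussianCertificateDefs (gaussPinH)
open Summit.QuantumFields.YangMills.Theorems.BalabanUVNodesN11Sect3SupplyChainDefs (Sect3Supplier)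
open Summit.QuantumFields.YangMills.Theorems.BalabanUVNodesN11Sect3SupplyChainObligationsDefs (SupplierObligations OperandRowsAlongChain)
open Summit.QuantumFields.YangMills.Theorems.BalabanUVNodesN11K1WitnessGaussPinHAtZ (provisos₁₃SepCoPH_gaussPinH_theta13OfThm1CCMWZ_door)
open Summit.QuantumFields.YangMills.BalabanUVNodes.N24K1R9ByNameSlot8Thm1AEInstPerKappaPrimeGuarded (N24_stabilityBRunRowsAtRecordR13SepCoPHV_byName_of_openStubsGridG_of_childrenSplitPerKappaPrimeGuardedThm1AE_atGaussPinZ_of_runRowsCont)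
open Summit.QuantumFields.YangMills.BalabanUVNodes.N05SubBP2DK2PerKappaSlotExistsOfBindersLettersPerDoorL (exists_residB8_slot8κ'_of_bindersLettersPer_doorL)

/-- **★★★★ THE K1-FACE N05 JUNCTION — K1⁹ `StabilityBRunRowsAtRecordR13SepCoPHV` (stmt-QuantumFields-27364) BY ITS ROUTE NAME on the V21-G ∕ θᴳᶻ slot road at the witness slot of record
`Slot8κ′` (p658298 §2), WITH N05 READ THROUGH THE EDITION OF RECORD ζ-L `exists_residB8_slot8κ'_of_bindersLettersPer_doorL` (p673108; director-ym №235∕№236: N05's discharge record) BY NAME** — p672260's twin on ζ-L (the ONE difference: ζ-L's `hLet` text carries one more insertion, [4] (L4)): the `h05` family of p658298 §2 is REPLACED by `hN05` — per door tuple,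
at θZ₃ := `(theta13OfThm1CCMWZ F 2 j γ … (Efl F) (logz F)).toStage3Params`, an ∃-package of ζ's displayed binders VERBATIM (NODE N06's genuine torus record data `τ, C_τ, ops₀, M ≥ 1`, N06's binder
constants `a_I a_T a_S B₀ᴺ C_β c_S c_Sβ` with signs, the Hölder pair `β, len`, [4]'s Prop-5 letter constants `B₀′ᴴ B₂′ B_G B_R c_L` with signs, N06's FIVE analytic binder predicates
`InvAtHIPer ∕ GlobAtIPer ∕ HolderAtIH2Per ∕ SrcAtIPer ∕ SrcHolderAtIH2Per` per print-class periodic member and truncation, and [4]'s two letter families `hLet` (existence, periodic arguments) ∕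
`SLetUB` (uniqueness, periodic members of record)) — NOTHING of N05's own: the Prop-6 door (dag-n05-e), every free scalar and every (8′)∕(9′) inequality are discharged INSIDE ζ; the three
θZ₃ facts are discharged HERE (`FiniteDimensional ℝ θZ₃.𝔸` by `Node00.finiteDimensional_𝔸_stage3OfFamily F` (EDITION №262: formerly `show FiniteDimensional ℝ ℂ`), `2 ≤ θZ₃.D` by `show 2 ≤ 4`, `5 ≤ θZ₃.L` from `F.hL11`); `(M₁, R)` outer with NOTE-371a's
supplier-side guard `1 ≤ M₁` displayed; period `P := M₁·θZ₃.L` (ζ's).  The K1-face N05 bill is now N06's binders + [4]'s letters at print-class periodic members — N06 ∕ IR-N05-P5NS content.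
CONDITIONAL (every family displayed; audit `proof.conditional`); not a closure; NO v10 ∕ V21-G stub used as proved or closed; N05 NOT discharged by this file (the chair books discharges on the
N05 lane's «DISCHARGE CLAIMED» + referee reads); N06 ∕ N11 ∕ N13 NOT discharged; no count moved.
[cite: Balaban1985RegularSpaces, Lemma 1 p.79 – Thm 8 p.101, Prop. 5 p.94, (1.3)–(1.5) p.77, Prop. 6 p.99, Prop. 7 (1.145) p.100; Balaban1985BackgroundPropagators, Thm 3.1 p.397, Thms 3.2–3.3 p.399, Thm 3.11, (3.45)–(3.47); Balaban1989LargeFieldII, Thm 1 p.355, (0.1) pp.355–356, (0.15) p.360; Balaban1988Convergent, Theorem p.245, Cor. 3 (2.50) p.264, (3.16)–(3.25) pp.268–270; Balaban1987RG1, Thm 3 p.264, §1 pp.263–264 (bookkeeping)] -/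
theorem N24_stabilityBRunRowsAtRecordR13SepCoPHV_byName_of_openStubsGridG_of_n05BindersLettersLSlot8KappaPrime_atGaussPinZ_of_runRowsCont (M₁ R : ℕ) (hM₁ : 1 ≤ M₁) (Efl logz : (F : T4Family) → B12.RunParams → ℕ → ℝ)
    (h1G3 : ∀ F : T4Family, ∃ (c c₀ c₁ : ℕ) (B₃ a₀ a₁ : ℝ), 2 * (F.L : ℝ) ^ 2 ≤ B₃ ∧ 0 < a₀ ∧ 0 < a₁ ∧
      Prop8RegSepTopStepG F 2 (fun ν K Ω => suppDomOfRecord F ν K Ω) (fun ν M g K k _s => c ≤ ν.M₁ ∧ k + c₀ ≤ F.m + K ∧ F.L ^ c₁ ∣ M ∧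
      ∀ i, 1 ≤ i → i ≤ k → dCubeSide (F.P K).L M (RkOfRecord (F.P K).L ν.r (g i)) i ∣ (F.P K).sitesPerDir 0) B₃ a₀ a₁)
    (h3A'G3 : ∀ F : T4Family, ∀ (j c c₀ c₁ : ℕ) (B₃ B₃' a₀ a₁ : ℝ), c ≤ F.L ^ j → c₀ ≤ j + 1 → c₁ ≤ j → 2 * (F.L : ℝ) ^ 2 ≤ B₃ → 0 < B₃' → 0 < a₀ → 0 < a₁ →
      VariationalThm1RegSepCoP7MG F 2 (fun ν M g K k _s => c ≤ ν.M₁ ∧ k + c₀ ≤ F.m + K ∧ F.L ^ c₁ ∣ M ∧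
      ∀ i, 1 ≤ i → i ≤ k → dCubeSide (F.P K).L M (RkOfRecord (F.P K).L ν.r (g i)) i ∣ (F.P K).sitesPerDir 0) B₃ a₀ a₁ →
      Gauge9RegSepTopStepG F 2 (fun ν K Ω => suppDomOfRecord F ν K Ω) (F.L ^ j) (fun ν M g K k _s => c ≤ ν.M₁ ∧ k + c₀ ≤ F.m + K ∧ F.L ^ c₁ ∣ M ∧
      ∀ i, 1 ≤ i → i ≤ k → dCubeSide (F.P K).L M (RkOfRecord (F.P K).L ν.r (g i)) i ∣ (F.P K).sitesPerDir 0) B₃ B₃' a₀ a₁ →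
      ∃ γ₀ ε₀ ε₂₉ β' : ℝ, 0 < γ₀ ∧ 0 < ε₀ ∧ 0 < ε₂₉ ∧
        BetaLowerH (-β') γ₀ (betaOfRecord₁₃ F 2 (theta13OfThm1CCM F 2 j ε₀ ε₂₉ B₃ B₃' a₀ a₁)) ∧
        BetaUpperH β' γ₀ (betaOfRecord₁₃ F 2 (theta13OfThm1CCM F 2 j ε₀ ε₂₉ B₃ B₃' a₀ a₁)))
    (hN05 : ∀ (F : T4Family) {j : ℕ} {γ ε₀ ε₂₉ B₃ B₃' a₀ a₁ : ℝ} (hγ₀ : 0 < γ) (hγh : γ ≤ 1 / 2) (hε : 0 < ε₀) (hε' : 0 < ε₂₉) (hB : 0 ≤ B₃) (hB' : 0 ≤ B₃') (ha₀ : 0 < a₀) (ha₁ : 0 < a₁) {bl β' : ℝ} (hbox : BetaLowerH bl γ (betaOfRecord₁₃ F 2 (theta13OfThm1CCMWZ F 2 j γ ε₀ ε₂₉ B₃ B₃' a₀ a₁ (Efl F) (logz F)))) (hbox' : BetaUpperH β' γ (betaOfRecord₁₃ F 2 (theta13OfThm1CCMWZ F 2 j γ ε₀ ε₂₉ B₃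 B₃' a₀ a₁ (Efl F) (logz F)))) (hl : -bl * γ ^ 2 ≤ 3) (hβ' : β' * γ ^ 2 ≤ 3 / 4) [FiniteDimensional ℝ (theta13OfThm1CCMWZ F 2 j γ ε₀ ε₂₉ B₃ B₃' a₀ a₁ (Efl F) (logz F)).toStage3Params.𝔸],
      ∃ (τ : (theta13OfThm1CCMWZ F 2 j γ ε₀ ε₂₉ B₃ B₃' a₀ a₁ (Efl F) (logz F)).toStage3Params.𝔸 →ₗ[ℂ] ℂ) (Cτ : ℝ) (ops₀ : ℝ → ZdIdx (theta13OfThm1CCMWZ F 2 j γ ε₀ ε₂₉ B₃ B₃' a₀ a₁ (Efl F) (logz F)).toStage3Params.D (theta13OfThm1CCMWZ F 2 j γ ε₀ ε₂₉ B₃ B₃' a₀ a₁ (Efl F) (logz F)).toStage3Params.L → ℕ → OpsZd (theta13OfThm1CCMWZ F 2 j γ ε₀ ε₂₉ B₃ B₃' a₀ a₁ (Efl F) (logz F)).toStage3Params.D (theta13OfThm1CCMWZ F 2 j γ ε₀ ε₂₉ B₃ B₃' a₀ a₁ (Efl F) (logz F)).toStage3Params.𝔸)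
        (M aI aT aS B₀N Cβ cS cSβ β : ℝ) (len : B7Prop1Explicit.Site (theta13OfThm1CCMWZ F 2 j γ ε₀ ε₂₉ B₃ B₃' a₀ a₁ (Efl F) (logz F)).toStage3Params.D → ℝ) (B₀'H B₂' BG BR cL : ℝ),
        (∀ a : (theta13OfThm1CCMWZ F 2 j γ ε₀ ε₂₉ B₃ B₃' a₀ a₁ (Efl F) (logz F)).toStage3Params.𝔸, a ≠ 0 → 0 < (τ (star a * a)).re) ∧ (∀ a b : (theta13OfThm1CCMWZ F 2 j γ ε₀ ε₂₉ B₃ B₃' a₀ a₁ (Efl F) (logz F)).toStage3Params.𝔸, τ (a * b) = τ (b * a)) ∧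
        (∀ a : (theta13OfThm1CCMWZ F 2 j γ ε₀ ε₂₉ B₃ B₃' a₀ a₁ (Efl F) (logz F)).toStage3Params.𝔸, τ (star a) = starRingEnd ℂ (τ a)) ∧ (∀ x y : (theta13OfThm1CCMWZ F 2 j γ ε₀ ε₂₉ B₃ B₃' a₀ a₁ (Efl F) (logz F)).toStage3Params.𝔸, |(τ (star x * y)).re| ≤ Cτ * ‖x‖ * ‖y‖) ∧ 1 ≤ M ∧
        0 < aI ∧ 0 < aT ∧ 0 < aS ∧ 0 < B₀N ∧ 0 < Cβ ∧ 0 ≤ cS ∧ 0 ≤ cSβ ∧ 0 < B₀'H ∧ 0 ≤ B₂' ∧ 0 ≤ BG ∧ 0 ≤ BR ∧ 0 < cL ∧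
        (∀ (a : IdxB8SubDPerκ (theta13OfThm1CCMWZ F 2 j γ ε₀ ε₂₉ B₃ B₃' a₀ a₁ (Efl F) (logz F)).toStage3Params (M₁ * (theta13OfThm1CCMWZ F 2 j γ ε₀ ε₂₉ B₃ B₃' a₀ a₁ (Efl F) (logz F)).toStage3Params.L) M₁ R) (m : ℕ), m ≤ a.toZdIdx.k →
      InvAtHIPer (M₁ * (theta13OfThm1CCMWZ F 2 j γ ε₀ ε₂₉ B₃ B₃' a₀ a₁ (Efl F) (logz F)).toStage3Params.L) (theta13OfThm1CCMWZ F 2 j γ ε₀ ε₂₉ B₃ B₃' a₀ a₁ (Efl F) (logz F)).toStage3Params.L (opsAllZdPer τ (theta13OfThm1CCMWZ F 2 j γ ε₀ ε₂₉ B₃ B₃' a₀ a₁ (Efl F) (logz F)).toStage3Params.L (M₁ * (theta13OfThm1CCMWZ F 2 j γ ε₀ ε₂₉ B₃ B₃' a₀ a₁ (Efl F) (logz F)).toStage3Params.L) (fun k j => towerBondsP (theta13OfThm1CCMWZ F 2 j γ ε₀ ε₂₉ B₃ B₃' a₀ a₁ (Efl F) (logz F)).toStage3Params.L a.toZdIdx.Ω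 (a.toZdIdx.Λs k) j) ops₀) aI M a.toZdIdx m) ∧
        (∀ (a : IdxB8SubDPerκ (theta13OfThm1CCMWZ F 2 j γ ε₀ ε₂₉ B₃ B₃' a₀ a₁ (Efl F) (logz F)).toStage3Params (M₁ * (theta13OfThm1CCMWZ F 2 j γ ε₀ ε₂₉ B₃ B₃' a₀ a₁ (Efl F) (logz F)).toStage3Params.L) M₁ R) (m : ℕ), m ≤ a.toZdIdx.k →
      GlobAtIPer (M₁ * (theta13OfThm1CCMWZ F 2 j γ ε₀ ε₂₉ B₃ B₃' a₀ a₁ (Efl F) (logz F)).toStage3Params.L) (theta13OfThm1CCMWZ F 2 j γ ε₀ ε₂₉ B₃ B₃' a₀ a₁ (Efl F) (logz F)).toStage3Params.L (opsAllZdPer τ (theta13OfThm1CCMWZ F 2 j γ ε₀ ε₂₉ B₃ B₃' a₀ a₁ (Efl F) (logz F)).toStage3Params.L (M₁ * (theta13OfThm1CCMWZ F 2 j γ ε₀ ε₂₉ B₃ B₃' a₀ a₁ (Efl F) (logz F)).toStage3Params.L) (fun k j => towerBondsP (theta13OfThm1CCMWZ F 2 j γ ε₀ ε₂₉ B₃ B₃'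 a₀ a₁ (Efl F) (logz F)).toStage3Params.L a.toZdIdx.Ω (a.toZdIdx.Λs k) j) ops₀) aT B₀N M a.toZdIdx m) ∧
        (∀ (a : IdxB8SubDPerκ (theta13OfThm1CCMWZ F 2 j γ ε₀ ε₂₉ B₃ B₃' a₀ a₁ (Efl F) (logz F)).toStage3Params (M₁ * (theta13OfThm1CCMWZ F 2 j γ ε₀ ε₂₉ B₃ B₃' a₀ a₁ (Efl F) (logz F)).toStage3Params.L) M₁ R) (m : ℕ), m ≤ a.toZdIdx.k →
      HolderAtIH2Per (M₁ * (theta13OfThm1CCMWZ F 2 j γ ε₀ ε₂₉ B₃ B₃' a₀ a₁ (Efl F) (logz F)).toStage3Params.L) (theta13OfThm1CCMWZ F 2 j γ ε₀ ε₂₉ B₃ B₃' a₀ a₁ (Efl F) (logz F)).toStage3Params.L (opsAllZdPer τ (theta13OfThm1CCMWZ F 2 j γ ε₀ ε₂₉ B₃ B₃' a₀ a₁ (Efl F) (logz F)).toStage3Params.L (M₁ * (theta13OfThm1CCMWZ F 2 j γ ε₀ ε₂₉ B₃ B₃' a₀ a₁ (Efl F) (logz F)).toStage3Params.L) (fun k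 j => towerBondsP (theta13OfThm1CCMWZ F 2 j γ ε₀ ε₂₉ B₃ B₃' a₀ a₁ (Efl F) (logz F)).toStage3Params.L a.toZdIdx.Ω (a.toZdIdx.Λs k) j) ops₀) aT Cβ β len M a.toZdIdx m) ∧
        (∀ (a : IdxB8SubDPerκ (theta13OfThm1CCMWZ F 2 j γ ε₀ ε₂₉ B₃ B₃' a₀ a₁ (Efl F) (logz F)).toStage3Params (M₁ * (theta13OfThm1CCMWZ F 2 j γ ε₀ ε₂₉ B₃ B₃' a₀ a₁ (Efl F) (logz F)).toStage3Params.L) M₁ R) (m : ℕ), m ≤ a.toZdIdx.k →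
      SrcAtIPer (M₁ * (theta13OfThm1CCMWZ F 2 j γ ε₀ ε₂₉ B₃ B₃' a₀ a₁ (Efl F) (logz F)).toStage3Params.L) (theta13OfThm1CCMWZ F 2 j γ ε₀ ε₂₉ B₃ B₃' a₀ a₁ (Efl F) (logz F)).toStage3Params.L (opsAllZdPer τ (theta13OfThm1CCMWZ F 2 j γ ε₀ ε₂₉ B₃ B₃' a₀ a₁ (Efl F) (logz F)).toStage3Params.L (M₁ * (theta13OfThm1CCMWZ F 2 j γ ε₀ ε₂₉ B₃ B₃' a₀ a₁ (Efl F) (logz F)).toStage3Params.L) (fun k j => towerBondsP (theta13OfThm1CCMWZ F 2 j γ ε₀ ε₂₉ B₃ B₃' a₀ a₁ (Efl F) (logz F)).toStage3Params.L a.toZdIdx.Ω (a.toZdIdx.Λs k) j) ops₀) aS cS M a.toZdIdx m) ∧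
        (∀ (a : IdxB8SubDPerκ (theta13OfThm1CCMWZ F 2 j γ ε₀ ε₂₉ B₃ B₃' a₀ a₁ (Efl F) (logz F)).toStage3Params (M₁ * (theta13OfThm1CCMWZ F 2 j γ ε₀ ε₂₉ B₃ B₃' a₀ a₁ (Efl F) (logz F)).toStage3Params.L) M₁ R) (m : ℕ), m ≤ a.toZdIdx.k →
      SrcHolderAtIH2Per (M₁ * (theta13OfThm1CCMWZ F 2 j γ ε₀ ε₂₉ B₃ B₃' a₀ a₁ (Efl F) (logz F)).toStage3Params.L) (theta13OfThm1CCMWZ F 2 j γ ε₀ ε₂₉ B₃ B₃' a₀ a₁ (Efl F) (logz F)).toStage3Params.L (opsAllZdPer τ (theta13OfThm1CCMWZ F 2 j γ ε₀ ε₂₉ B₃ B₃' a₀ a₁ (Efl F) (logz F)).toStage3Params.L (M₁ * (theta13OfThm1CCMWZ F 2 j γ ε₀ ε₂₉ B₃ B₃' a₀ a₁ (Efl F) (logz F)).toStage3Params.L) (fun k j => towerBondsP (theta13OfThm1CCMWZ F 2 j γ ε₀ ε₂₉ B₃ B₃' a₀ a₁ (Efl F) (logz F)).toStage3Params.L a.toZdIdx.Ω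 (a.toZdIdx.Λs k) j) ops₀) aS cSβ β len M a.toZdIdx m) ∧
        (∀ a : IdxB8SubDPerκ (theta13OfThm1CCMWZ F 2 j γ ε₀ ε₂₉ B₃ B₃' a₀ a₁ (Efl F) (logz F)).toStage3Params (M₁ * (theta13OfThm1CCMWZ F 2 j γ ε₀ ε₂₉ B₃ B₃' a₀ a₁ (Efl F) (logz F)).toStage3Params.L) M₁ R, ∀ α₀ : ℝ, 0 < α₀ → α₀ ≤ cL → ∀ U₀ : B7Prop1Explicit.Site (theta13OfThm1CCMWZ F 2 j γ ε₀ ε₂₉ B₃ B₃' a₀ a₁ (Efl F) (logz F)).toStage3Params.D → Fin (theta13OfThm1CCMWZ F 2 j γ ε₀ ε₂₉ B₃ B₃' a₀ a₁ (Efl F) (logz F)).toStage3Params.D → (theta13OfThm1CCMWZ F 2 j γ ε₀ ε₂₉ B₃ B₃' a₀ a₁ (Efl F) (logz F)).toStage3Params.𝔸ˣ, (∀ x κ, U₀ x κ ∈ unitaryUnits (theta13OfThm1CCMWZ F 2 j γ ε₀ ε₂₉ B₃ B₃' a₀ a₁ (Efl F) (logz F)).toStage3Params.𝔸) → IsPeriodic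 (M₁ * (theta13OfThm1CCMWZ F 2 j γ ε₀ ε₂₉ B₃ B₃' a₀ a₁ (Efl F) (logz F)).toStage3Params.L) U₀ →
      InAk (theta13OfThm1CCMWZ F 2 j γ ε₀ ε₂₉ B₃ B₃' a₀ a₁ (Efl F) (logz F)).toStage3Params.L a.toZdIdx.k a.toZdIdx.η α₀ a.toZdIdx.Ω U₀ → ∀ n, 1 ≤ n → n ≤ a.toZdIdx.k →
      ∃ (g Δ : (B7Prop1Explicit.Site (theta13OfThm1CCMWZ F 2 j γ ε₀ ε₂₉ B₃ B₃' a₀ a₁ (Efl F) (logz F)).toStage3Params.D → (theta13OfThm1CCMWZ F 2 j γ ε₀ ε₂₉ B₃ B₃' a₀ a₁ (Efl F) (logz F)).toStage3Params.𝔸) →ₗ[ℂ] (B7Prop1Explicit.Site (theta13OfThm1CCMWZ F 2 j γ ε₀ ε₂₉ B₃ B₃' a₀ a₁ (Efl F) (logz F)).toStage3Params.D → (theta13OfThm1CCMWZ F 2 j γ ε₀ ε₂₉ B₃ B₃' a₀ a₁ (Efl F) (logz F)).toStage3Params.𝔸)) (q : (B7Prop1Explicit.Site (theta13OfThm1CCMWZ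 F 2 j γ ε₀ ε₂₉ B₃ B₃' a₀ a₁ (Efl F) (logz F)).toStage3Params.D → (theta13OfThm1CCMWZ F 2 j γ ε₀ ε₂₉ B₃ B₃' a₀ a₁ (Efl F) (logz F)).toStage3Params.𝔸) →ₗ[ℂ] (ℕ → B7Prop1Explicit.Site (theta13OfThm1CCMWZ F 2 j γ ε₀ ε₂₉ B₃ B₃' a₀ a₁ (Efl F) (logz F)).toStage3Params.D → (theta13OfThm1CCMWZ F 2 j γ ε₀ ε₂₉ B₃ B₃' a₀ a₁ (Efl F) (logz F)).toStage3Params.𝔸)) (qs : (ℕ → B7Prop1Explicit.Site (theta13OfThm1CCMWZ F 2 j γ ε₀ ε₂₉ B₃ B₃' a₀ a₁ (Efl F) (logz F)).toStage3Params.D → (theta13OfThm1CCMWZ F 2 j γ ε₀ ε₂₉ B₃ B₃' a₀ a₁ (Efl F) (logz F)).toStage3Params.𝔸) →ₗ[ℂ] (B7Prop1Explicit.Site (theta13OfThm1CCMWZ F 2 j γ ε₀ ε₂₉ B₃ B₃' a₀ a₁ (Efl F) (logz F)).toStage3Params.D → (theta13OfThm1CCMWZ F 2 j γ ε₀ ε₂₉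 B₃ B₃' a₀ a₁ (Efl F) (logz F)).toStage3Params.𝔸))
        (Aw c : (ℕ → B7Prop1Explicit.Site (theta13OfThm1CCMWZ F 2 j γ ε₀ ε₂₉ B₃ B₃' a₀ a₁ (Efl F) (logz F)).toStage3Params.D → (theta13OfThm1CCMWZ F 2 j γ ε₀ ε₂₉ B₃ B₃' a₀ a₁ (Efl F) (logz F)).toStage3Params.𝔸) →ₗ[ℂ] (ℕ → B7Prop1Explicit.Site (theta13OfThm1CCMWZ F 2 j γ ε₀ ε₂₉ B₃ B₃' a₀ a₁ (Efl F) (logz F)).toStage3Params.D → (theta13OfThm1CCMWZ F 2 j γ ε₀ ε₂₉ B₃ B₃' a₀ a₁ (Efl F) (logz F)).toStage3Params.𝔸)) (H' : XSpace (theta13OfThm1CCMWZ F 2 j γ ε₀ ε₂₉ B₃ B₃' a₀ a₁ (Efl F) (logz F)).toStage3Params.D n (theta13OfThm1CCMWZ F 2 j γ ε₀ ε₂₉ B₃ B₃' a₀ a₁ (Efl F) (logz F)).toStage3Params.𝔸 →ₗ[ℂ] (B7Prop1Explicit.Site (theta13OfThm1CCMWZ F 2 j γ ε₀ ε₂₉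 B₃ B₃' a₀ a₁ (Efl F) (logz F)).toStage3Params.D → (theta13OfThm1CCMWZ F 2 j γ ε₀ ε₂₉ B₃ B₃' a₀ a₁ (Efl F) (logz F)).toStage3Params.𝔸)),
        (∀ x, (∀ (z : B7Prop1Explicit.Site (theta13OfThm1CCMWZ F 2 j γ ε₀ ε₂₉ B₃ B₃' a₀ a₁ (Efl F) (logz F)).toStage3Params.D) (i : Fin (theta13OfThm1CCMWZ F 2 j γ ε₀ ε₂₉ B₃ B₃' a₀ a₁ (Efl F) (logz F)).toStage3Params.D), x (z + ((M₁ * (theta13OfThm1CCMWZ F 2 j γ ε₀ ε₂₉ B₃ B₃' a₀ a₁ (Efl F) (logz F)).toStage3Params.L) : ℤ) • B7Prop1Explicit.e i) = x z) → ∀ y ∈ a.toZdIdx.Ω 0, (Δ (g x) + qs (Aw (q (g x)))) y = x y) ∧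
        (∀ f, (∀ (z : B7Prop1Explicit.Site (theta13OfThm1CCMWZ F 2 j γ ε₀ ε₂₉ B₃ B₃' a₀ a₁ (Efl F) (logz F)).toStage3Params.D) (i : Fin (theta13OfThm1CCMWZ F 2 j γ ε₀ ε₂₉ B₃ B₃' a₀ a₁ (Efl F) (logz F)).toStage3Params.D), f (z + ((M₁ * (theta13OfThm1CCMWZ F 2 j γ ε₀ ε₂₉ B₃ B₃' a₀ a₁ (Efl F) (logz F)).toStage3Params.L) : ℤ) • B7Prop1Explicit.e i) = f z) → q (g (g (qs (c (q f))))) = q f) ∧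
        (∀ (f : B7Prop1Explicit.Site (theta13OfThm1CCMWZ F 2 j γ ε₀ ε₂₉ B₃ B₃' a₀ a₁ (Efl F) (logz F)).toStage3Params.D → (theta13OfThm1CCMWZ F 2 j γ ε₀ ε₂₉ B₃ B₃' a₀ a₁ (Efl F) (logz F)).toStage3Params.𝔸) (z : B7Prop1Explicit.Site (theta13OfThm1CCMWZ F 2 j γ ε₀ ε₂₉ B₃ B₃' a₀ a₁ (Efl F) (logz F)).toStage3Params.D) (i : Fin (theta13OfThm1CCMWZ F 2 j γ ε₀ ε₂₉ B₃ B₃' a₀ a₁ (Efl F) (logz F)).toStage3Params.D), g f (z + ((M₁ * (theta13OfThm1CCMWZ F 2 j γ ε₀ ε₂₉ B₃ B₃' a₀ a₁ (Efl F) (logz F)).toStage3Params.L) : ℤ) • B7Prop1Explicit.e i) = g f z) ∧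
        (∀ f : B7Prop1Explicit.Site (theta13OfThm1CCMWZ F 2 j γ ε₀ ε₂₉ B₃ B₃' a₀ a₁ (Efl F) (logz F)).toStage3Params.D → (theta13OfThm1CCMWZ F 2 j γ ε₀ ε₂₉ B₃ B₃' a₀ a₁ (Efl F) (logz F)).toStage3Params.𝔸, (∀ (z : B7Prop1Explicit.Site (theta13OfThm1CCMWZ F 2 j γ ε₀ ε₂₉ B₃ B₃' a₀ a₁ (Efl F) (logz F)).toStage3Params.D) (i : Fin (theta13OfThm1CCMWZ F 2 j γ ε₀ ε₂₉ B₃ B₃' a₀ a₁ (Efl F) (logz F)).toStage3Params.D), f (z + ((M₁ * (theta13OfThm1CCMWZ F 2 j γ ε₀ ε₂₉ B₃ B₃' a₀ a₁ (Efl F) (logz F)).toStage3Params.L) : ℤ) • B7Prop1Explicit.e i) = f z) →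
      ∀ (z : B7Prop1Explicit.Site (theta13OfThm1CCMWZ F 2 j γ ε₀ ε₂₉ B₃ B₃' a₀ a₁ (Efl F) (logz F)).toStage3Params.D) (i : Fin (theta13OfThm1CCMWZ F 2 j γ ε₀ ε₂₉ B₃ B₃' a₀ a₁ (Efl F) (logz F)).toStage3Params.D), qs (c (q f)) (z + ((M₁ * (theta13OfThm1CCMWZ F 2 j γ ε₀ ε₂₉ B₃ B₃' a₀ a₁ (Efl F) (logz F)).toStage3Params.L) : ℤ) • B7Prop1Explicit.e i) = qs (c (q f)) z) ∧
        (∀ (f : B7Prop1Explicit.Site (theta13OfThm1CCMWZ F 2 j γ ε₀ ε₂₉ B₃ B₃' a₀ a₁ (Efl F) (logz F)).toStage3Params.D → (theta13OfThm1CCMWZ F 2 j γ ε₀ ε₂₉ B₃ B₃' a₀ a₁ (Efl F) (logz F)).toStage3Params.𝔸), ∀ x ∈ a.toZdIdx.Ω 0, Δ f x = covLap a.toZdIdx.η U₀ ((a.toZdIdx.Ω 0).indicator f) x) ∧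
        (∀ (μ : ℕ → B7Prop1Explicit.Site (theta13OfThm1CCMWZ F 2 j γ ε₀ ε₂₉ B₃ B₃' a₀ a₁ (Efl F) (logz F)).toStage3Params.D → (theta13OfThm1CCMWZ F 2 j γ ε₀ ε₂₉ B₃ B₃' a₀ a₁ (Efl F) (logz F)).toStage3Params.𝔸), ∀ x ∈ a.toZdIdx.Ω 0, qs μ x = QT (theta13OfThm1CCMWZ F 2 j γ ε₀ ε₂₉ B₃ B₃' a₀ a₁ (Efl F) (logz F)).toStage3Params.L n (a.toZdIdx.Λs n) U₀ μ x) ∧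
        (∀ (f : B7Prop1Explicit.Site (theta13OfThm1CCMWZ F 2 j γ ε₀ ε₂₉ B₃ B₃' a₀ a₁ (Efl F) (logz F)).toStage3Params.D → (theta13OfThm1CCMWZ F 2 j γ ε₀ ε₂₉ B₃ B₃' a₀ a₁ (Efl F) (logz F)).toStage3Params.𝔸) (j : ℕ), j ≤ n → ∀ y ∈ a.toZdIdx.Λs n j, q f j y = QprimeIter (zdBlocking (theta13OfThm1CCMWZ F 2 j γ ε₀ ε₂₉ B₃ B₃' a₀ a₁ (Efl F) (logz F)).toStage3Params.D (theta13OfThm1CCMWZ F 2 j γ ε₀ ε₂₉ B₃ B₃' a₀ a₁ (Efl F) (logz F)).toStage3Params.L) (bgT (theta13OfThm1CCMWZ F 2 j γ ε₀ ε₂₉ B₃ B₃' a₀ a₁ (Efl F) (logz F)).toStage3Params.L U₀) j f y) ∧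
        (∀ (X : XSpace (theta13OfThm1CCMWZ F 2 j γ ε₀ ε₂₉ B₃ B₃' a₀ a₁ (Efl F) (logz F)).toStage3Params.D n (theta13OfThm1CCMWZ F 2 j γ ε₀ ε₂₉ B₃ B₃' a₀ a₁ (Efl F) (logz F)).toStage3Params.𝔸) (x : B7Prop1Explicit.Site (theta13OfThm1CCMWZ F 2 j γ ε₀ ε₂₉ B₃ B₃' a₀ a₁ (Efl F) (logz F)).toStage3Params.D), ‖H' X x‖ ≤ B₀'H * ‖X‖) ∧
        (∀ j, j ≤ n → ∀ (X : XSpace (theta13OfThm1CCMWZ F 2 j γ ε₀ ε₂₉ B₃ B₃' a₀ a₁ (Efl F) (logz F)).toStage3Params.D n (theta13OfThm1CCMWZ F 2 j γ ε₀ ε₂₉ B₃ B₃' a₀ a₁ (Efl F) (logz F)).toStage3Params.𝔸), ∀ b ∈ {b : B7Prop1Explicit.Site (theta13OfThm1CCMWZ F 2 j γ ε₀ ε₂₉ B₃ B₃' a₀ a₁ (Efl F) (logz F)).toStage3Params.D × Fin (theta13OfThm1CCMWZ F 2 j γ ε₀ ε₂₉ B₃ B₃' a₀ a₁ (Efl F)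 (logz F)).toStage3Params.D | SideTouches (a.toZdIdx.Ω j) b.1 b.2},
      wt (theta13OfThm1CCMWZ F 2 j γ ε₀ ε₂₉ B₃ B₃' a₀ a₁ (Efl F) (logz F)).toStage3Params.L a.toZdIdx.η j * ‖covDerivFwd a.toZdIdx.η U₀ b.2 (H' X) b.1‖ ≤ B₀'H * ‖X‖) ∧
        (∀ X : XSpace (theta13OfThm1CCMWZ F 2 j γ ε₀ ε₂₉ B₃ B₃' a₀ a₁ (Efl F) (logz F)).toStage3Params.D n (theta13OfThm1CCMWZ F 2 j γ ε₀ ε₂₉ B₃ B₃' a₀ a₁ (Efl F) (logz F)).toStage3Params.𝔸, Bd2 (theta13OfThm1CCMWZ F 2 j γ ε₀ ε₂₉ B₃ B₃' a₀ a₁ (Efl F) (logz F)).toStage3Params.L a.toZdIdx.η n a.toZdIdx.Ω (covLap a.toZdIdx.η U₀ (H' X)) (B₂' * ‖X‖)) ∧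
        (∀ (X : XSpace (theta13OfThm1CCMWZ F 2 j γ ε₀ ε₂₉ B₃ B₃' a₀ a₁ (Efl F) (logz F)).toStage3Params.D n (theta13OfThm1CCMWZ F 2 j γ ε₀ ε₂₉ B₃ B₃' a₀ a₁ (Efl F) (logz F)).toStage3Params.𝔸) (x : B7Prop1Explicit.Site (theta13OfThm1CCMWZ F 2 j γ ε₀ ε₂₉ B₃ B₃' a₀ a₁ (Efl F) (logz F)).toStage3Params.D), x ∉ a.toZdIdx.Ω 0 → H' X x = 0) ∧
        (∀ X Y : XSpace (theta13OfThm1CCMWZ F 2 j γ ε₀ ε₂₉ B₃ B₃' a₀ a₁ (Efl F) (logz F)).toStage3Params.D n (theta13OfThm1CCMWZ F 2 j γ ε₀ ε₂₉ B₃ B₃' a₀ a₁ (Efl F) (logz F)).toStage3Params.𝔸, (∀ b, Y b = -star (X b)) → ∀ x, H' Y x = -star (H' X x)) ∧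
        (∀ X : XSpace (theta13OfThm1CCMWZ F 2 j γ ε₀ ε₂₉ B₃ B₃' a₀ a₁ (Efl F) (logz F)).toStage3Params.D n (theta13OfThm1CCMWZ F 2 j γ ε₀ ε₂₉ B₃ B₃' a₀ a₁ (Efl F) (logz F)).toStage3Params.𝔸, (∀ (b : Fin (n + 1) × B7Prop1Explicit.Site (theta13OfThm1CCMWZ F 2 j γ ε₀ ε₂₉ B₃ B₃' a₀ a₁ (Efl F) (logz F)).toStage3Params.D) (i : Fin (theta13OfThm1CCMWZ F 2 j γ ε₀ ε₂₉ B₃ B₃' a₀ a₁ (Efl F) (logz F)).toStage3Params.D), X (b.1, b.2 + (((M₁ * (theta13OfThm1CCMWZ F 2 j γ ε₀ ε₂₉ B₃ B₃' a₀ a₁ (Efl F) (logz F)).toStage3Params.L) : ℤ) / ((theta13OfThm1CCMWZ F 2 j γ ε₀ ε₂₉ B₃ B₃' a₀ a₁ (Efl F) (logz F)).toStage3Params.L : ℤ) ^ (b.1 : ℕ)) • B7Prop1Explicit.e i) = X b) →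
      ∀ (z : B7Prop1Explicit.Site (theta13OfThm1CCMWZ F 2 j γ ε₀ ε₂₉ B₃ B₃' a₀ a₁ (Efl F) (logz F)).toStage3Params.D) (i : Fin (theta13OfThm1CCMWZ F 2 j γ ε₀ ε₂₉ B₃ B₃' a₀ a₁ (Efl F) (logz F)).toStage3Params.D), H' X (z + ((M₁ * (theta13OfThm1CCMWZ F 2 j γ ε₀ ε₂₉ B₃ B₃' a₀ a₁ (Efl F) (logz F)).toStage3Params.L) : ℤ) • B7Prop1Explicit.e i) = H' X z) ∧
        (∀ (Y : XSpace (theta13OfThm1CCMWZ F 2 j γ ε₀ ε₂₉ B₃ B₃' a₀ a₁ (Efl F) (logz F)).toStage3Params.D n (theta13OfThm1CCMWZ F 2 j γ ε₀ ε₂₉ B₃ B₃' a₀ a₁ (Efl F) (logz F)).toStage3Params.𝔸), (∀ (b : Fin (n + 1) × B7Prop1Explicit.Site (theta13OfThm1CCMWZ F 2 j γ ε₀ ε₂₉ B₃ B₃' a₀ a₁ (Efl F) (logz F)).toStage3Params.D) (i : Fin (theta13OfThm1CCMWZ F 2 j γ ε₀ ε₂₉ B₃ B₃' a₀ a₁ (Efl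 F) (logz F)).toStage3Params.D), Y (b.1, b.2 + (((M₁ * (theta13OfThm1CCMWZ F 2 j γ ε₀ ε₂₉ B₃ B₃' a₀ a₁ (Efl F) (logz F)).toStage3Params.L) : ℤ) / ((theta13OfThm1CCMWZ F 2 j γ ε₀ ε₂₉ B₃ B₃' a₀ a₁ (Efl F) (logz F)).toStage3Params.L : ℤ) ^ (b.1 : ℕ)) • B7Prop1Explicit.e i) = Y b) →
      ∀ (j : ℕ) (hj : j ≤ n) (y : B7Prop1Explicit.Site (theta13OfThm1CCMWZ F 2 j γ ε₀ ε₂₉ B₃ B₃' a₀ a₁ (Efl F) (logz F)).toStage3Params.D), y ∈ a.toZdIdx.Λs n j →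
      QprimeIter (zdBlocking (theta13OfThm1CCMWZ F 2 j γ ε₀ ε₂₉ B₃ B₃' a₀ a₁ (Efl F) (logz F)).toStage3Params.D (theta13OfThm1CCMWZ F 2 j γ ε₀ ε₂₉ B₃ B₃' a₀ a₁ (Efl F) (logz F)).toStage3Params.L) (bgT (theta13OfThm1CCMWZ F 2 j γ ε₀ ε₂₉ B₃ B₃' a₀ a₁ (Efl F) (logz F)).toStage3Params.L U₀) j (H' Y) y = Y (⟨j, Nat.lt_succ_of_le hj⟩, y)) ∧
        (∀ (f : B7Prop1Explicit.Site (theta13OfThm1CCMWZ F 2 j γ ε₀ ε₂₉ B₃ B₃' a₀ a₁ (Efl F) (logz F)).toStage3Params.D → (theta13OfThm1CCMWZ F 2 j γ ε₀ ε₂₉ B₃ B₃' a₀ a₁ (Efl F) (logz F)).toStage3Params.𝔸) (r : ℝ), 0 ≤ r → Bd2 (theta13OfThm1CCMWZ F 2 j γ ε₀ ε₂₉ B₃ B₃' a₀ a₁ (Efl F) (logz F)).toStage3Params.L a.toZdIdx.η n a.toZdIdx.Ω f r →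
      (∀ x, ‖g f x‖ ≤ BG * r) ∧ ∀ j, j ≤ n → ∀ b ∈ {b : B7Prop1Explicit.Site (theta13OfThm1CCMWZ F 2 j γ ε₀ ε₂₉ B₃ B₃' a₀ a₁ (Efl F) (logz F)).toStage3Params.D × Fin (theta13OfThm1CCMWZ F 2 j γ ε₀ ε₂₉ B₃ B₃' a₀ a₁ (Efl F) (logz F)).toStage3Params.D | SideTouches (a.toZdIdx.Ω j) b.1 b.2},
        wt (theta13OfThm1CCMWZ F 2 j γ ε₀ ε₂₉ B₃ B₃' a₀ a₁ (Efl F) (logz F)).toStage3Params.L a.toZdIdx.η j * ‖covDerivFwd a.toZdIdx.η U₀ b.2 (g f) b.1‖ ≤ BG * r) ∧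
        (∀ (f : B7Prop1Explicit.Site (theta13OfThm1CCMWZ F 2 j γ ε₀ ε₂₉ B₃ B₃' a₀ a₁ (Efl F) (logz F)).toStage3Params.D → (theta13OfThm1CCMWZ F 2 j γ ε₀ ε₂₉ B₃ B₃' a₀ a₁ (Efl F) (logz F)).toStage3Params.𝔸) (x : B7Prop1Explicit.Site (theta13OfThm1CCMWZ F 2 j γ ε₀ ε₂₉ B₃ B₃' a₀ a₁ (Efl F) (logz F)).toStage3Params.D), x ∉ a.toZdIdx.Ω 0 → g f x = 0) ∧
        (∀ f : B7Prop1Explicit.Site (theta13OfThm1CCMWZ F 2 j γ ε₀ ε₂₉ B₃ B₃' a₀ a₁ (Efl F) (logz F)).toStage3Params.D → (theta13OfThm1CCMWZ F 2 j γ ε₀ ε₂₉ B₃ B₃' a₀ a₁ (Efl F) (logz F)).toStage3Params.𝔸, (∀ j, j ≤ n → ∀ x ∈ a.toZdIdx.Ω j, IsSelfAdjoint (f x)) → ∀ x, IsSelfAdjoint (g f x)) ∧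
        (∀ (f : B7Prop1Explicit.Site (theta13OfThm1CCMWZ F 2 j γ ε₀ ε₂₉ B₃ B₃' a₀ a₁ (Efl F) (logz F)).toStage3Params.D → (theta13OfThm1CCMWZ F 2 j γ ε₀ ε₂₉ B₃ B₃' a₀ a₁ (Efl F) (logz F)).toStage3Params.𝔸) (r : ℝ), 0 ≤ r → Bd2 (theta13OfThm1CCMWZ F 2 j γ ε₀ ε₂₉ B₃ B₃' a₀ a₁ (Efl F) (logz F)).toStage3Params.L a.toZdIdx.η n a.toZdIdx.Ω f r → Bd2 (theta13OfThm1CCMWZ F 2 j γ ε₀ ε₂₉ B₃ B₃' a₀ a₁ (Efl F) (logz F)).toStage3Params.L a.toZdIdx.η n a.toZdIdx.Ω (f - g (qs (c (q (g f))))) (BR * r)) ∧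
        (∀ f : B7Prop1Explicit.Site (theta13OfThm1CCMWZ F 2 j γ ε₀ ε₂₉ B₃ B₃' a₀ a₁ (Efl F) (logz F)).toStage3Params.D → (theta13OfThm1CCMWZ F 2 j γ ε₀ ε₂₉ B₃ B₃' a₀ a₁ (Efl F) (logz F)).toStage3Params.𝔸, (∀ j, j ≤ n → ∀ x ∈ a.toZdIdx.Ω j, IsSelfAdjoint (f x)) →
      ∀ j, j ≤ n → ∀ x ∈ a.toZdIdx.Ω j, IsSelfAdjoint ((f - g (qs (c (q (g f))))) x))) ∧
        (∀ a : IdxB8LanCκPer (theta13OfThm1CCMWZ F 2 j γ ε₀ ε₂₉ B₃ B₃' a₀ a₁ (Efl F) (logz F)).toStage3Params (M₁ * (theta13OfThm1CCMWZ F 2 j γ ε₀ ε₂₉ B₃ B₃' a₀ a₁ (Efl F) (logz F)).toStage3Params.L) M₁ R, ∀ α₀ : ℝ, 0 < α₀ → α₀ ≤ cL → InAk (theta13OfThm1CCMWZ F 2 j γ ε₀ ε₂₉ B₃ B₃' a₀ a₁ (Efl F) (logz F)).toStage3Params.L a.toZdLanIdx.k a.toZdLanIdx.η α₀ a.toZdLanIdx.Ω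 a.toZdLanIdx.U₀ →
      ∃ (g Δ : (B7Prop1Explicit.Site (theta13OfThm1CCMWZ F 2 j γ ε₀ ε₂₉ B₃ B₃' a₀ a₁ (Efl F) (logz F)).toStage3Params.D → (theta13OfThm1CCMWZ F 2 j γ ε₀ ε₂₉ B₃ B₃' a₀ a₁ (Efl F) (logz F)).toStage3Params.𝔸) →ₗ[ℂ] (B7Prop1Explicit.Site (theta13OfThm1CCMWZ F 2 j γ ε₀ ε₂₉ B₃ B₃' a₀ a₁ (Efl F) (logz F)).toStage3Params.D → (theta13OfThm1CCMWZ F 2 j γ ε₀ ε₂₉ B₃ B₃' a₀ a₁ (Efl F) (logz F)).toStage3Params.𝔸)) (q : (B7Prop1Explicit.Site (theta13OfThm1CCMWZ F 2 j γ ε₀ ε₂₉ B₃ B₃' a₀ a₁ (Efl F) (logz F)).toStage3Params.D → (theta13OfThm1CCMWZ F 2 j γ ε₀ ε₂₉ B₃ B₃' a₀ a₁ (Efl F) (logz F)).toStage3Params.𝔸) →ₗ[ℂ] (ℕ → B7Prop1Explicit.Site (theta13OfThm1CCMWZ F 2 j γ ε₀ ε₂₉ B₃ B₃' a₀ a₁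 (Efl F) (logz F)).toStage3Params.D → (theta13OfThm1CCMWZ F 2 j γ ε₀ ε₂₉ B₃ B₃' a₀ a₁ (Efl F) (logz F)).toStage3Params.𝔸)) (qs : (ℕ → B7Prop1Explicit.Site (theta13OfThm1CCMWZ F 2 j γ ε₀ ε₂₉ B₃ B₃' a₀ a₁ (Efl F) (logz F)).toStage3Params.D → (theta13OfThm1CCMWZ F 2 j γ ε₀ ε₂₉ B₃ B₃' a₀ a₁ (Efl F) (logz F)).toStage3Params.𝔸) →ₗ[ℂ] (B7Prop1Explicit.Site (theta13OfThm1CCMWZ F 2 j γ ε₀ ε₂₉ B₃ B₃' a₀ a₁ (Efl F) (logz F)).toStage3Params.D → (theta13OfThm1CCMWZ F 2 j γ ε₀ ε₂₉ B₃ B₃' a₀ a₁ (Efl F) (logz F)).toStage3Params.𝔸))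
        (Aw c : (ℕ → B7Prop1Explicit.Site (theta13OfThm1CCMWZ F 2 j γ ε₀ ε₂₉ B₃ B₃' a₀ a₁ (Efl F) (logz F)).toStage3Params.D → (theta13OfThm1CCMWZ F 2 j γ ε₀ ε₂₉ B₃ B₃' a₀ a₁ (Efl F) (logz F)).toStage3Params.𝔸) →ₗ[ℂ] (ℕ → B7Prop1Explicit.Site (theta13OfThm1CCMWZ F 2 j γ ε₀ ε₂₉ B₃ B₃' a₀ a₁ (Efl F) (logz F)).toStage3Params.D → (theta13OfThm1CCMWZ F 2 j γ ε₀ ε₂₉ B₃ B₃' a₀ a₁ (Efl F) (logz F)).toStage3Params.𝔸)) (H' : XSpace (theta13OfThm1CCMWZ F 2 j γ ε₀ ε₂₉ B₃ B₃' a₀ a₁ (Efl F) (logz F)).toStage3Params.D a.toZdLanIdx.k (theta13OfThm1CCMWZ F 2 j γ ε₀ ε₂₉ B₃ B₃' a₀ a₁ (Efl F) (logz F)).toStage3Params.𝔸 →ₗ[ℂ] (B7Prop1Explicit.Site (theta13OfThm1CCMWZ F 2 j γ ε₀ ε₂₉ B₃ B₃' a₀ a₁ (Efl F) (logz F)).toStage3Params.D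 → (theta13OfThm1CCMWZ F 2 j γ ε₀ ε₂₉ B₃ B₃' a₀ a₁ (Efl F) (logz F)).toStage3Params.𝔸)),
        (∀ x : B7Prop1Explicit.Site (theta13OfThm1CCMWZ F 2 j γ ε₀ ε₂₉ B₃ B₃' a₀ a₁ (Efl F) (logz F)).toStage3Params.D → (theta13OfThm1CCMWZ F 2 j γ ε₀ ε₂₉ B₃ B₃' a₀ a₁ (Efl F) (logz F)).toStage3Params.𝔸, (∀ (z : B7Prop1Explicit.Site (theta13OfThm1CCMWZ F 2 j γ ε₀ ε₂₉ B₃ B₃' a₀ a₁ (Efl F) (logz F)).toStage3Params.D) (i : Fin (theta13OfThm1CCMWZ F 2 j γ ε₀ ε₂₉ B₃ B₃' a₀ a₁ (Efl F) (logz F)).toStage3Params.D), x (z + ((M₁ * (theta13OfThm1CCMWZ F 2 j γ ε₀ ε₂₉ B₃ B₃' a₀ a₁ (Efl F) (logz F)).toStage3Params.L) : ℤ) • B7Prop1Explicit.e i) = x z) → (∃ C : ℝ, ∀ y, ‖x y‖ ≤ C) →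
          g (Δ x + qs (Aw (q x))) = x) ∧
        (∀ φ : ℕ → B7Prop1Explicit.Site (theta13OfThm1CCMWZ F 2 j γ ε₀ ε₂₉ B₃ B₃' a₀ a₁ (Efl F) (logz F)).toStage3Params.D → (theta13OfThm1CCMWZ F 2 j γ ε₀ ε₂₉ B₃ B₃' a₀ a₁ (Efl F) (logz F)).toStage3Params.𝔸, (∀ n, n ≤ a.toZdLanIdx.k → ∀ (y : B7Prop1Explicit.Site (theta13OfThm1CCMWZ F 2 j γ ε₀ ε₂₉ B₃ B₃' a₀ a₁ (Efl F) (logz F)).toStage3Params.D) (i : Fin (theta13OfThm1CCMWZ F 2 j γ ε₀ ε₂₉ B₃ B₃' a₀ a₁ (Efl F) (logz F)).toStage3Params.D), φ n (y + (((M₁ * (theta13OfThm1CCMWZ F 2 j γ ε₀ ε₂₉ B₃ B₃' a₀ a₁ (Efl F) (logz F)).toStage3Params.L) : ℤ) / ((theta13OfThm1CCMWZ F 2 j γ ε₀ ε₂₉ B₃ B₃' a₀ a₁ (Efl F) (logz F)).toStage3Params.L : ℤ) ^ n) • B7Prop1Explicit.e i) = φ n y) →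
          qs (c (q (g (g (qs φ))))) = qs φ) ∧
        (∀ (f : B7Prop1Explicit.Site (theta13OfThm1CCMWZ F 2 j γ ε₀ ε₂₉ B₃ B₃' a₀ a₁ (Efl F) (logz F)).toStage3Params.D → (theta13OfThm1CCMWZ F 2 j γ ε₀ ε₂₉ B₃ B₃' a₀ a₁ (Efl F) (logz F)).toStage3Params.𝔸), ∀ x ∈ a.toZdLanIdx.Ω 0, Δ f x = covLap a.toZdLanIdx.η a.toZdLanIdx.U₀ ((a.toZdLanIdx.Ω 0).indicator f) x) ∧
        (∀ (μ : ℕ → B7Prop1Explicit.Site (theta13OfThm1CCMWZ F 2 j γ ε₀ ε₂₉ B₃ B₃' a₀ a₁ (Efl F) (logz F)).toStage3Params.D → (theta13OfThm1CCMWZ F 2 j γ ε₀ ε₂₉ B₃ B₃' a₀ a₁ (Efl F) (logz F)).toStage3Params.𝔸), ∀ x ∈ a.toZdLanIdx.Ω 0, qs μ x = QT (theta13OfThm1CCMWZ F 2 j γ ε₀ ε₂₉ B₃ B₃' a₀ a₁ (Efl F) (logz F)).toStage3Params.L a.toZdLanIdx.k a.toZdLanIdx.Λ a.toZdLanIdx.U₀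 μ x) ∧
        (∀ (f : B7Prop1Explicit.Site (theta13OfThm1CCMWZ F 2 j γ ε₀ ε₂₉ B₃ B₃' a₀ a₁ (Efl F) (logz F)).toStage3Params.D → (theta13OfThm1CCMWZ F 2 j γ ε₀ ε₂₉ B₃ B₃' a₀ a₁ (Efl F) (logz F)).toStage3Params.𝔸) (n : ℕ), n ≤ a.toZdLanIdx.k → ∀ y ∈ a.toZdLanIdx.Λ n, q f n y = QprimeIter (zdBlocking (theta13OfThm1CCMWZ F 2 j γ ε₀ ε₂₉ B₃ B₃' a₀ a₁ (Efl F) (logz F)).toStage3Params.D (theta13OfThm1CCMWZ F 2 j γ ε₀ ε₂₉ B₃ B₃' a₀ a₁ (Efl F) (logz F)).toStage3Params.L) (bgT (theta13OfThm1CCMWZ F 2 j γ ε₀ ε₂₉ B₃ B₃' a₀ a₁ (Efl F) (logz F)).toStage3Params.L a.toZdLanIdx.U₀) n f y) ∧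
        (∀ (f : B7Prop1Explicit.Site (theta13OfThm1CCMWZ F 2 j γ ε₀ ε₂₉ B₃ B₃' a₀ a₁ (Efl F) (logz F)).toStage3Params.D → (theta13OfThm1CCMWZ F 2 j γ ε₀ ε₂₉ B₃ B₃' a₀ a₁ (Efl F) (logz F)).toStage3Params.𝔸) (n : ℕ) (y : B7Prop1Explicit.Site (theta13OfThm1CCMWZ F 2 j γ ε₀ ε₂₉ B₃ B₃' a₀ a₁ (Efl F) (logz F)).toStage3Params.D), ¬ (n ≤ a.toZdLanIdx.k ∧ y ∈ a.toZdLanIdx.Λ n) → q f n y = 0) ∧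
        (∀ (f : B7Prop1Explicit.Site (theta13OfThm1CCMWZ F 2 j γ ε₀ ε₂₉ B₃ B₃' a₀ a₁ (Efl F) (logz F)).toStage3Params.D → (theta13OfThm1CCMWZ F 2 j γ ε₀ ε₂₉ B₃ B₃' a₀ a₁ (Efl F) (logz F)).toStage3Params.𝔸) (z : B7Prop1Explicit.Site (theta13OfThm1CCMWZ F 2 j γ ε₀ ε₂₉ B₃ B₃' a₀ a₁ (Efl F) (logz F)).toStage3Params.D) (i : Fin (theta13OfThm1CCMWZ F 2 j γ ε₀ ε₂₉ B₃ B₃' a₀ a₁ (Efl F) (logz F)).toStage3Params.D), g f (z + ((M₁ * (theta13OfThm1CCMWZ F 2 j γ ε₀ ε₂₉ B₃ B₃' a₀ a₁ (Efl F) (logz F)).toStage3Params.L) : ℤ) • B7Prop1Explicit.e i) = g f z) ∧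
        (∀ μ : ℕ → B7Prop1Explicit.Site (theta13OfThm1CCMWZ F 2 j γ ε₀ ε₂₉ B₃ B₃' a₀ a₁ (Efl F) (logz F)).toStage3Params.D → (theta13OfThm1CCMWZ F 2 j γ ε₀ ε₂₉ B₃ B₃' a₀ a₁ (Efl F) (logz F)).toStage3Params.𝔸, ∀ n, n ≤ a.toZdLanIdx.k → ∀ (y : B7Prop1Explicit.Site (theta13OfThm1CCMWZ F 2 j γ ε₀ ε₂₉ B₃ B₃' a₀ a₁ (Efl F) (logz F)).toStage3Params.D) (i : Fin (theta13OfThm1CCMWZ F 2 j γ ε₀ ε₂₉ B₃ B₃' a₀ a₁ (Efl F) (logz F)).toStage3Params.D), Aw μ n (y + (((M₁ * (theta13OfThm1CCMWZ F 2 j γ ε₀ ε₂₉ B₃ B₃' a₀ a₁ (Efl F) (logz F)).toStage3Params.L) : ℤ) / ((theta13OfThm1CCMWZ F 2 j γ ε₀ ε₂₉ B₃ B₃' a₀ a₁ (Efl F) (logz F)).toStage3Params.L : ℤ) ^ n) • B7Prop1Explicit.e i) = Aw μ n y) ∧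
        (∀ (X : XSpace (theta13OfThm1CCMWZ F 2 j γ ε₀ ε₂₉ B₃ B₃' a₀ a₁ (Efl F) (logz F)).toStage3Params.D a.toZdLanIdx.k (theta13OfThm1CCMWZ F 2 j γ ε₀ ε₂₉ B₃ B₃' a₀ a₁ (Efl F) (logz F)).toStage3Params.𝔸) (x : B7Prop1Explicit.Site (theta13OfThm1CCMWZ F 2 j γ ε₀ ε₂₉ B₃ B₃' a₀ a₁ (Efl F) (logz F)).toStage3Params.D), ‖H' X x‖ ≤ B₀'H * ‖X‖) ∧
        (∀ n, n ≤ a.toZdLanIdx.k → ∀ (X : XSpace (theta13OfThm1CCMWZ F 2 j γ ε₀ ε₂₉ B₃ B₃' a₀ a₁ (Efl F) (logz F)).toStage3Params.D a.toZdLanIdx.k (theta13OfThm1CCMWZ F 2 j γ ε₀ ε₂₉ B₃ B₃' a₀ a₁ (Efl F) (logz F)).toStage3Params.𝔸), ∀ b ∈ {b : B7Prop1Explicit.Site (theta13OfThm1CCMWZ F 2 j γ ε₀ ε₂₉ B₃ B₃' a₀ a₁ (Efl F) (logz F)).toStage3Params.D × Fin (theta13OfThm1CCMWZ F 2 j γ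 ε₀ ε₂₉ B₃ B₃' a₀ a₁ (Efl F) (logz F)).toStage3Params.D | SideTouches (a.toZdLanIdx.Ω n) b.1 b.2},
          wt (theta13OfThm1CCMWZ F 2 j γ ε₀ ε₂₉ B₃ B₃' a₀ a₁ (Efl F) (logz F)).toStage3Params.L a.toZdLanIdx.η n * ‖covDerivFwd a.toZdLanIdx.η a.toZdLanIdx.U₀ b.2 (H' X) b.1‖ ≤ B₀'H * ‖X‖) ∧
        (∀ X : XSpace (theta13OfThm1CCMWZ F 2 j γ ε₀ ε₂₉ B₃ B₃' a₀ a₁ (Efl F) (logz F)).toStage3Params.D a.toZdLanIdx.k (theta13OfThm1CCMWZ F 2 j γ ε₀ ε₂₉ B₃ B₃' a₀ a₁ (Efl F) (logz F)).toStage3Params.𝔸, Bd2 (theta13OfThm1CCMWZ F 2 j γ ε₀ ε₂₉ B₃ B₃' a₀ a₁ (Efl F) (logz F)).toStage3Params.L a.toZdLanIdx.η a.toZdLanIdx.k a.toZdLanIdx.Ω (covLap a.toZdLanIdx.η a.toZdLanIdx.U₀ (H' X)) (B₂' * ‖X‖)) ∧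
        (∀ X : XSpace (theta13OfThm1CCMWZ F 2 j γ ε₀ ε₂₉ B₃ B₃' a₀ a₁ (Efl F) (logz F)).toStage3Params.D a.toZdLanIdx.k (theta13OfThm1CCMWZ F 2 j γ ε₀ ε₂₉ B₃ B₃' a₀ a₁ (Efl F) (logz F)).toStage3Params.𝔸, (∀ (q : Fin (a.toZdLanIdx.k + 1) × B7Prop1Explicit.Site (theta13OfThm1CCMWZ F 2 j γ ε₀ ε₂₉ B₃ B₃' a₀ a₁ (Efl F) (logz F)).toStage3Params.D) (i : Fin (theta13OfThm1CCMWZ F 2 j γ ε₀ ε₂₉ B₃ B₃' a₀ a₁ (Efl F) (logz F)).toStage3Params.D), X (q.1, q.2 + (((M₁ * (theta13OfThm1CCMWZ F 2 j γ ε₀ ε₂₉ B₃ B₃' a₀ a₁ (Efl F) (logz F)).toStage3Params.L) : ℤ) / ((theta13OfThm1CCMWZ F 2 j γ ε₀ ε₂₉ B₃ B₃' a₀ a₁ (Efl F) (logz F)).toStage3Params.L : ℤ) ^ (q.1 : ℕ)) • B7Prop1Explicit.e i) = X q) →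
          ∀ (z : B7Prop1Explicit.Site (theta13OfThm1CCMWZ F 2 j γ ε₀ ε₂₉ B₃ B₃' a₀ a₁ (Efl F) (logz F)).toStage3Params.D) (i : Fin (theta13OfThm1CCMWZ F 2 j γ ε₀ ε₂₉ B₃ B₃' a₀ a₁ (Efl F) (logz F)).toStage3Params.D), H' X (z + ((M₁ * (theta13OfThm1CCMWZ F 2 j γ ε₀ ε₂₉ B₃ B₃' a₀ a₁ (Efl F) (logz F)).toStage3Params.L) : ℤ) • B7Prop1Explicit.e i) = H' X z) ∧
        (∀ (Y : XSpace (theta13OfThm1CCMWZ F 2 j γ ε₀ ε₂₉ B₃ B₃' a₀ a₁ (Efl F) (logz F)).toStage3Params.D a.toZdLanIdx.k (theta13OfThm1CCMWZ F 2 j γ ε₀ ε₂₉ B₃ B₃' a₀ a₁ (Efl F) (logz F)).toStage3Params.𝔸), (∀ (q : Fin (a.toZdLanIdx.k + 1) × B7Prop1Explicit.Site (theta13OfThm1CCMWZ F 2 j γ ε₀ ε₂₉ B₃ B₃' a₀ a₁ (Efl F) (logz F)).toStage3Params.D) (i : Fin (theta13OfThm1CCMWZ F 2 j γ ε₀ ε₂₉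 B₃ B₃' a₀ a₁ (Efl F) (logz F)).toStage3Params.D), Y (q.1, q.2 + (((M₁ * (theta13OfThm1CCMWZ F 2 j γ ε₀ ε₂₉ B₃ B₃' a₀ a₁ (Efl F) (logz F)).toStage3Params.L) : ℤ) / ((theta13OfThm1CCMWZ F 2 j γ ε₀ ε₂₉ B₃ B₃' a₀ a₁ (Efl F) (logz F)).toStage3Params.L : ℤ) ^ (q.1 : ℕ)) • B7Prop1Explicit.e i) = Y q) →
          ∀ (n : ℕ) (hn : n ≤ a.toZdLanIdx.k) (y : B7Prop1Explicit.Site (theta13OfThm1CCMWZ F 2 j γ ε₀ ε₂₉ B₃ B₃' a₀ a₁ (Efl F) (logz F)).toStage3Params.D), y ∈ a.toZdLanIdx.Λ n →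
          QprimeIter (zdBlocking (theta13OfThm1CCMWZ F 2 j γ ε₀ ε₂₉ B₃ B₃' a₀ a₁ (Efl F) (logz F)).toStage3Params.D (theta13OfThm1CCMWZ F 2 j γ ε₀ ε₂₉ B₃ B₃' a₀ a₁ (Efl F) (logz F)).toStage3Params.L) (bgT (theta13OfThm1CCMWZ F 2 j γ ε₀ ε₂₉ B₃ B₃' a₀ a₁ (Efl F) (logz F)).toStage3Params.L a.toZdLanIdx.U₀) n (H' Y) y = Y (⟨n, Nat.lt_succ_of_le hn⟩, y)) ∧
        (∀ (f : B7Prop1Explicit.Site (theta13OfThm1CCMWZ F 2 j γ ε₀ ε₂₉ B₃ B₃' a₀ a₁ (Efl F) (logz F)).toStage3Params.D → (theta13OfThm1CCMWZ F 2 j γ ε₀ ε₂₉ B₃ B₃' a₀ a₁ (Efl F) (logz F)).toStage3Params.𝔸) (r : ℝ), 0 ≤ r → Bd2 (theta13OfThm1CCMWZ F 2 j γ ε₀ ε₂₉ B₃ B₃' a₀ a₁ (Efl F) (logz F)).toStage3Params.L a.toZdLanIdx.η a.toZdLanIdx.k a.toZdLanIdx.Ω f r →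
          (∀ x, ‖g f x‖ ≤ BG * r) ∧ ∀ n, n ≤ a.toZdLanIdx.k → ∀ b ∈ {b : B7Prop1Explicit.Site (theta13OfThm1CCMWZ F 2 j γ ε₀ ε₂₉ B₃ B₃' a₀ a₁ (Efl F) (logz F)).toStage3Params.D × Fin (theta13OfThm1CCMWZ F 2 j γ ε₀ ε₂₉ B₃ B₃' a₀ a₁ (Efl F) (logz F)).toStage3Params.D | SideTouches (a.toZdLanIdx.Ω n) b.1 b.2},
            wt (theta13OfThm1CCMWZ F 2 j γ ε₀ ε₂₉ B₃ B₃' a₀ a₁ (Efl F) (logz F)).toStage3Params.L a.toZdLanIdx.η n * ‖covDerivFwd a.toZdLanIdx.η a.toZdLanIdx.U₀ b.2 (g f) b.1‖ ≤ BG * r) ∧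
        (∀ (f : B7Prop1Explicit.Site (theta13OfThm1CCMWZ F 2 j γ ε₀ ε₂₉ B₃ B₃' a₀ a₁ (Efl F) (logz F)).toStage3Params.D → (theta13OfThm1CCMWZ F 2 j γ ε₀ ε₂₉ B₃ B₃' a₀ a₁ (Efl F) (logz F)).toStage3Params.𝔸) (r : ℝ), 0 ≤ r → Bd2 (theta13OfThm1CCMWZ F 2 j γ ε₀ ε₂₉ B₃ B₃' a₀ a₁ (Efl F) (logz F)).toStage3Params.L a.toZdLanIdx.η a.toZdLanIdx.k a.toZdLanIdx.Ω f r →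
          Bd2 (theta13OfThm1CCMWZ F 2 j γ ε₀ ε₂₉ B₃ B₃' a₀ a₁ (Efl F) (logz F)).toStage3Params.L a.toZdLanIdx.η a.toZdLanIdx.k a.toZdLanIdx.Ω (f - g (qs (c (q (g f))))) (BR * r))))
    (h06 : ∀ (F : T4Family) {j : ℕ} {γ ε₀ ε₂₉ B₃ B₃' a₀ a₁ : ℝ} (hγ₀ : 0 < γ) (hγh : γ ≤ 1 / 2) (hε : 0 < ε₀) (hε' : 0 < ε₂₉) (hB : 0 ≤ B₃) (hB' : 0 ≤ B₃') (ha₀ : 0 < a₀) (ha₁ : 0 < a₁) {bl β' : ℝ} (hbox : BetaLowerH bl γ (betaOfRecord₁₃ F 2 (theta13OfThm1CCMWZ F 2 j γ ε₀ ε₂₉ B₃ B₃' a₀ a₁ (Efl F) (logz F)))) (hbox' : BetaUpperH β' γ (betaOfRecord₁₃ F 2 (theta13OfThm1CCMWZ F 2 j γ ε₀ ε₂₉ B₃ B₃' a₀ a₁ (Efl F) (logz F)))) (hl : -bl * γ ^ 2 ≤ 3) (hβ' : β' * γ ^ 2 ≤ 3 / 4),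
      ∃ (Mstar : ℕ) (ops : OpsY 2 (theta13OfThm1CCMWZ F 2 j γ ε₀ ε₂₉ B₃ B₃' a₀ a₁ (Efl F) (logz F)).toStage3Params Mstar), B9LeafX (Y9OfRecord 2 (theta13OfThm1CCMWZ F 2 j γ ε₀ ε₂₉ B₃ B₃' a₀ a₁ (Efl F) (logz F)).toStage3Params Mstar ops))
    (h07 : ∀ F : T4Family, ∃ ζ : ResidZ F 2, B11Leaf (Z11OfRecord F 2 ζ))
    (h08 : ∀ F : T4Family, PrintedUV3V 2 F.L)
    (h09 : ∀ (F : T4Family) {j : ℕ} {γ ε₀ ε₂₉ B₃ B₃' a₀ a₁ : ℝ} (hγ₀ : 0 < γ) (hγh : γ ≤ 1 / 2) (hε : 0 < ε₀) (hε' : 0 < ε₂₉) (hB : 0 ≤ B₃) (hB' : 0 ≤ B₃') (ha₀ : 0 < a₀) (ha₁ : 0 < a₁) {bl β' : ℝ} (hbox : BetaLowerH bl γ (betaOfRecord₁₃ F 2 (theta13OfThm1CCMWZ F 2 j γ ε₀ ε₂₉ B₃ B₃' a₀ a₁ (Efl F) (logz F)))) (hbox' : BetaUpperH β' γ (betaOfRecord₁₃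 F 2 (theta13OfThm1CCMWZ F 2 j γ ε₀ ε₂₉ B₃ B₃' a₀ a₁ (Efl F) (logz F)))) (hl : -bl * γ ^ 2 ≤ 3) (hβ' : β' * γ ^ 2 ≤ 3 / 4),
      ∃ lam12 : ResidB12 F 2 (theta13OfThm1CCMWZ F 2 j γ ε₀ ε₂₉ B₃ B₃' a₀ a₁ (Efl F) (logz F)).τ9.M,
      ∀ P : B12.RunParams, B12Sec2to5.Lemma4Printed (F12OfRecord₁₂ F 2 (theta13OfThm1CCMWZ F 2 j γ ε₀ ε₂₉ B₃ B₃' a₀ a₁ (Efl F) (logz F)).toStage12Params lam12 P) (lam12 P).consts)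
    (h09T : ∀ (F : T4Family) {j : ℕ} {γ ε₀ ε₂₉ B₃ B₃' a₀ a₁ : ℝ} (hγ₀ : 0 < γ) (hγh : γ ≤ 1 / 2) (hε : 0 < ε₀) (hε' : 0 < ε₂₉) (hB : 0 ≤ B₃) (hB' : 0 ≤ B₃') (ha₀ : 0 < a₀) (ha₁ : 0 < a₁) {bl β' : ℝ} (hbox : BetaLowerH bl γ (betaOfRecord₁₃ F 2 (theta13OfThm1CCMWZ F 2 j γ ε₀ ε₂₉ B₃ B₃' a₀ a₁ (Efl F) (logz F)))) (hbox' : BetaUpperH β' γ (betaOfRecord₁₃ F 2 (theta13OfThm1CCMWZ F 2 j γ ε₀ ε₂₉ B₃ B₃' a₀ a₁ (Efl F) (logz F)))) (hl : -bl * γ ^ 2 ≤ 3) (hβ' : β' * γ ^ 2 ≤ 3 / 4)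
      (hP : (gaussPinH (Stage13HParams.ofHistoryBlind F 2 ⟨theta13OfThm1CCMWZ F 2 j γ ε₀ ε₂₉ B₃ B₃' a₀ a₁ (Efl F) (logz F), ZrOfRecord₁₃ F 2 (theta13OfThm1CCMWZ F 2 j γ ε₀ ε₂₉ B₃ B₃' a₀ a₁ (Efl F) (logz F))⟩)).Provisos₁₃SepCoPH F 2),
      ∃ γ₉ : ℝ, 0 < γ₉ ∧ ∀ w : WorldP, w.C = (datumOfRecord₁₃SepCoPH F 2 (gaussPinH (Stage13HParams.ofHistoryBlind F 2 ⟨theta13OfThm1CCMWZ F 2 j γ ε₀ ε₂₉ B₃ B₃' a₀ a₁ (Efl F) (logz F), ZrOfRecord₁₃ F 2 (theta13OfThm1CCMWZ F 2 j γ ε₀ ε₂₉ B₃ B₃' a₀ a₁ (Efl F) (logz F))⟩)) hP).C →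
      w.γ ≤ γ₉ → ∀ P : B12.RunParams, (leavesP w P).smallCouplings → (leavesP w P).smallFieldInductive)
    (h10 : ∀ (F : T4Family) {j : ℕ} {γ ε₀ ε₂₉ B₃ B₃' a₀ a₁ : ℝ} (hγ₀ : 0 < γ) (hγh : γ ≤ 1 / 2) (hε : 0 < ε₀) (hε' : 0 < ε₂₉) (hB : 0 ≤ B₃) (hB' : 0 ≤ B₃') (ha₀ : 0 < a₀) (ha₁ : 0 < a₁) {bl β' : ℝ} (hbox : BetaLowerH bl γ (betaOfRecord₁₃ F 2 (theta13OfThm1CCMWZ F 2 j γ ε₀ ε₂₉ B₃ B₃' a₀ a₁ (Efl F) (logz F)))) (hbox' : BetaUpperH β' γ (betaOfRecord₁₃ F 2 (theta13OfThm1CCMWZ F 2 j γ ε₀ ε₂₉ B₃ B₃' a₀ a₁ (Efl F) (logz F)))) (hl : -bl * γ ^ 2 ≤ 3) (hβ' : β' * γ ^ 2 ≤ 3 / 4),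
      ∃ lam13 : B12.RunParams → ResidB13 (theta13OfThm1CCMWZ F 2 j γ ε₀ ε₂₉ B₃ B₃' a₀ a₁ (Efl F) (logz F)).toStage3Params,
      ∀ P : B12.RunParams, B13LeafOfRecord (theta13OfThm1CCMWZ F 2 j γ ε₀ ε₂₉ B₃ B₃' a₀ a₁ (Efl F) (logz F)).toStage3Params (lam13 P))
    (h11N : ∀ (F : T4Family) {j : ℕ} {γ ε₀ ε₂₉ B₃ B₃' a₀ a₁ : ℝ} (hγ₀ : 0 < γ) (hγh : γ ≤ 1 / 2) (hε : 0 < ε₀) (hε' : 0 < ε₂₉) (hB : 0 ≤ B₃) (hB' : 0 ≤ B₃') (ha₀ : 0 < a₀) (ha₁ : 0 < a₁) {bl β' : ℝ} (hbox : BetaLowerH bl γ (betaOfRecord₁₃ F 2 (theta13OfThm1CCMWZ F 2 j γ ε₀ ε₂₉ B₃ B₃' a₀ a₁ (Efl F) (logz F)))) (hbox' : BetaUpperH β' γ (betaOfRecord₁₃ F 2 (theta13OfThm1CCMWZ F 2 j γ ε₀ ε₂₉ B₃ B₃' a₀ a₁ (Efl F) (logz F)))) (hl : -bl * γ ^ 2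 ≤ 3) (hβ' : β' * γ ^ 2 ≤ 3 / 4),
      ∃ σ : (P : B12.RunParams) → Sect3Supplier (gaussPinH (Stage13HParams.ofHistoryBlind F 2 ⟨theta13OfThm1CCMWZ F 2 j γ ε₀ ε₂₉ B₃ B₃' a₀ a₁ (Efl F) (logz F), ZrOfRecord₁₃ F 2 (theta13OfThm1CCMWZ F 2 j γ ε₀ ε₂₉ B₃ B₃' a₀ a₁ (Efl F) (logz F))⟩)) P,
        (∀ P : B12.RunParams, Step.InInterval γ P.K (gOfRecord₁₃ F 2 (theta13OfThm1CCMWZ F 2 j γ ε₀ ε₂₉ B₃ B₃' a₀ a₁ (Efl F) (logz F)) P) → SupplierObligations (gaussPinH (Stage13HParams.ofHistoryBlind F 2 ⟨theta13OfThm1CCMWZ F 2 j γ ε₀ ε₂₉ B₃ B₃' a₀ a₁ (Efl F) (logz F), ZrOfRecord₁₃ F 2 (theta13OfThm1CCMWZ F 2 j γ ε₀ ε₂₉ B₃ B₃' a₀ a₁ (Efl F) (logz F))⟩)) P (σ P)) ∧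
        (∀ P : B12.RunParams, Step.InInterval γ P.K (gOfRecord₁₃ F 2 (theta13OfThm1CCMWZ F 2 j γ ε₀ ε₂₉ B₃ B₃' a₀ a₁ (Efl F) (logz F)) P) → OperandRowsAlongChain (gaussPinH (Stage13HParams.ofHistoryBlind F 2 ⟨theta13OfThm1CCMWZ F 2 j γ ε₀ ε₂₉ B₃ B₃' a₀ a₁ (Efl F) (logz F), ZrOfRecord₁₃ F 2 (theta13OfThm1CCMWZ F 2 j γ ε₀ ε₂₉ B₃ B₃' a₀ a₁ (Efl F) (logz F))⟩)) P (σ P)))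
    (h13 : ∀ (F : T4Family) {j : ℕ} {γ ε₀ ε₂₉ B₃ B₃' a₀ a₁ : ℝ} (hγ₀ : 0 < γ) (hγh : γ ≤ 1 / 2) (hε : 0 < ε₀) (hε' : 0 < ε₂₉) (hB : 0 ≤ B₃) (hB' : 0 ≤ B₃') (ha₀ : 0 < a₀) (ha₁ : 0 < a₁) {bl β' : ℝ} (hbox : BetaLowerH bl γ (betaOfRecord₁₃ F 2 (theta13OfThm1CCMWZ F 2 j γ ε₀ ε₂₉ B₃ B₃' a₀ a₁ (Efl F) (logz F)))) (hbox' : BetaUpperH β' γ (betaOfRecord₁₃ F 2 (theta13OfThm1CCMWZ F 2 j γ ε₀ ε₂₉ B₃ B₃' a₀ a₁ (Efl F) (logz F)))) (hl : -bl * γ ^ 2 ≤ 3) (hβ' : β' * γ ^ 2 ≤ 3 / 4)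
      (hP : (gaussPinH (Stage13HParams.ofHistoryBlind F 2 ⟨theta13OfThm1CCMWZ F 2 j γ ε₀ ε₂₉ B₃ B₃' a₀ a₁ (Efl F) (logz F), ZrOfRecord₁₃ F 2 (theta13OfThm1CCMWZ F 2 j γ ε₀ ε₂₉ B₃ B₃' a₀ a₁ (Efl F) (logz F))⟩)).Provisos₁₃SepCoPH F 2),
      ∃ γ₁₃ : ℝ, 0 < γ₁₃ ∧ ∃ em ep : ℝ → ℝ,
        (∀ P : B12.RunParams, ((datumOfRecord₁₃SepCoPH F 2 (gaussPinH (Stage13HParams.ofHistoryBlind F 2 ⟨theta13OfThm1CCMWZ F 2 j γ ε₀ ε₂₉ B₃ B₃' a₀ a₁ (Efl F) (logz F), ZrOfRecord₁₃ F 2 (theta13OfThm1CCMWZ F 2 j γ ε₀ ε₂₉ B₃ B₃' a₀ a₁ (Efl F) (logz F))⟩)) hP).C P).flow.InInterval γ₁₃ P.K → SLaw₁₃CoPH F 2 (gaussPinH (Stage13HParams.ofHistoryBlind F 2 ⟨theta13OfThm1CCMWZ F 2 j γ ε₀ ε₂₉ B₃ B₃' a₀ a₁ (Efl F) (logz F),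 ZrOfRecord₁₃ F 2 (theta13OfThm1CCMWZ F 2 j γ ε₀ ε₂₉ B₃ B₃' a₀ a₁ (Efl F) (logz F))⟩)) P 0 →
      ∀ U : GaugeField (F.P P.K) 0 (SU 2),
        chiβOfRecord₁₃ F 2 (theta13OfThm1CCMWZ F 2 j γ ε₀ ε₂₉ B₃ B₃' a₀ a₁ (Efl F) (logz F)) P.K (gOfRecord₁₃ F 2 (theta13OfThm1CCMWZ F 2 j γ ε₀ ε₂₉ B₃ B₃' a₀ a₁ (Efl F) (logz F)) P) 0 U *
              Real.exp (-(1 / (gOfRecord₁₃ F 2 (theta13OfThm1CCMWZ F 2 j γ ε₀ ε₂₉ B₃ B₃' a₀ a₁ (Efl F) (logz F)) P 0) ^ 2 * wilsonBGOfRecord F 2 (theta13OfThm1CCMWZ F 2 j γ ε₀ ε₂₉ B₃ B₃' a₀ a₁ (Efl F) (logz F)).εbg P 0 U)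
                - em (gOfRecord₁₃ F 2 (theta13OfThm1CCMWZ F 2 j γ ε₀ ε₂₉ B₃ B₃' a₀ a₁ (Efl F) (logz F)) P 0) * (Fintype.card (Literature.MathematicalPhysics.QuantumFieldTheory.Balaban1983to89.Site (F.P P.K) 0) : ℝ)) ≤ densOfRecord₁₃ F 2 (theta13OfThm1CCMWZ F 2 j γ ε₀ ε₂₉ B₃ B₃' a₀ a₁ (Efl F) (logz F)) P 0 U ∧
          densOfRecord₁₃ F 2 (theta13OfThm1CCMWZ F 2 j γ ε₀ ε₂₉ B₃ B₃' a₀ a₁ (Efl F) (logz F)) P 0 U ≤ Real.exp (ep (gOfRecord₁₃ F 2 (theta13OfThm1CCMWZ F 2 j γ ε₀ ε₂₉ B₃ B₃' a₀ a₁ (Efl F) (logz F)) P 0) * (Fintype.card (Literature.MathematicalPhysics.QuantumFieldTheory.Balaban1983to89.Site (F.P P.K) 0) : ℝ))) ∧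
        (∀ P : B12.RunParams, ((datumOfRecord₁₃SepCoPH F 2 (gaussPinH (Stage13HParams.ofHistoryBlind F 2 ⟨theta13OfThm1CCMWZ F 2 j γ ε₀ ε₂₉ B₃ B₃' a₀ a₁ (Efl F) (logz F), ZrOfRecord₁₃ F 2 (theta13OfThm1CCMWZ F 2 j γ ε₀ ε₂₉ B₃ B₃' a₀ a₁ (Efl F) (logz F))⟩)) hP).C P).flow.InInterval γ₁₃ P.K → ∀ k, k + 1 ≤ P.K → SLaw₁₃CoPH F 2 (gaussPinH (Stage13HParams.ofHistoryBlind F 2 ⟨theta13OfThm1CCMWZ F 2 j γ ε₀ ε₂₉ B₃ B₃' a₀ a₁ (Efl F) (logz F), ZrOfRecord₁₃ F 2 (theta13OfThm1CCMWZ F 2 j γ ε₀ ε₂₉ B₃ B₃' a₀ a₁ (Efl F) (logz F))⟩)) P (k + 1) →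
      ∀ᵐ U ∂(fieldMeasure (F.P P.K) (k + 1) (SU 2)),
        chiβOfRecord₁₃ F 2 (theta13OfThm1CCMWZ F 2 j γ ε₀ ε₂₉ B₃ B₃' a₀ a₁ (Efl F) (logz F)) P.K (gOfRecord₁₃ F 2 (theta13OfThm1CCMWZ F 2 j γ ε₀ ε₂₉ B₃ B₃' a₀ a₁ (Efl F) (logz F)) P) (k + 1) U *
              Real.exp (-(1 / (gOfRecord₁₃ F 2 (theta13OfThm1CCMWZ F 2 j γ ε₀ ε₂₉ B₃ B₃' a₀ a₁ (Efl F) (logz F)) P (k + 1)) ^ 2 * wilsonBGOfRecord F 2 (theta13OfThm1CCMWZ F 2 j γ ε₀ ε₂₉ B₃ B₃' a₀ a₁ (Efl F) (logz F)).εbg P (k + 1) U)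
                - em (gOfRecord₁₃ F 2 (theta13OfThm1CCMWZ F 2 j γ ε₀ ε₂₉ B₃ B₃' a₀ a₁ (Efl F) (logz F)) P (k + 1)) * (Fintype.card (Literature.MathematicalPhysics.QuantumFieldTheory.Balaban1983to89.Site (F.P P.K) (k + 1)) : ℝ)) ≤ densOfRecord₁₃ F 2 (theta13OfThm1CCMWZ F 2 j γ ε₀ ε₂₉ B₃ B₃' a₀ a₁ (Efl F) (logz F)) P (k + 1) U ∧
          densOfRecord₁₃ F 2 (theta13OfThm1CCMWZ F 2 j γ ε₀ ε₂₉ B₃ B₃' a₀ a₁ (Efl F) (logz F)) P (k + 1) U ≤ Real.exp (ep (gOfRecord₁₃ F 2 (theta13OfThm1CCMWZ F 2 j γ ε₀ ε₂₉ B₃ B₃' a₀ a₁ (Efl F) (logz F)) P (k + 1)) * (Fintype.card (Literature.MathematicalPhysics.QuantumFieldTheory.Balaban1983to89.Site (F.P P.K) (k + 1)) : ℝ))))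
    (hrowsR : ∀ (F : T4Family) {j : ℕ} {γ ε₀ ε₂₉ B₃ B₃' a₀ a₁ : ℝ} (hγ₀ : 0 < γ) (hγh : γ ≤ 1 / 2) (hε : 0 < ε₀) (hε' : 0 < ε₂₉) (hB : 0 ≤ B₃) (hB' : 0 ≤ B₃') (ha₀ : 0 < a₀) (ha₁ : 0 < a₁) {bl β' : ℝ} (hbox : BetaLowerH bl γ (betaOfRecord₁₃ F 2 (theta13OfThm1CCMWZ F 2 j γ ε₀ ε₂₉ B₃ B₃' a₀ a₁ (Efl F) (logz F)))) (hbox' : BetaUpperH β' γ (betaOfRecord₁₃ F 2 (theta13OfThm1CCMWZ F 2 j γ ε₀ ε₂₉ B₃ B₃' a₀ a₁ (Efl F) (logz F)))) (hl : -bl * γ ^ 2 ≤ 3) (hβ' : β' * γ ^ 2 ≤ 3 / 4),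
      ∃ (b : ℕ → ℝ) (r γ₀ M : ℝ), 0 < γ₀ ∧
        (∀ (n : ℕ) (gs : ℕ → ℝ), RGEqH n (betaOfRecord₁₃ F 2 (theta13OfThm1CCMWZ F 2 j γ ε₀ ε₂₉ B₃ B₃' a₀ a₁ (Efl F) (logz F))) gs → Step.InInterval γ₀ n gs → ∀ k, k ≤ n → |betaOfRecord₁₃ F 2 (theta13OfThm1CCMWZ F 2 j γ ε₀ ε₂₉ B₃ B₃' a₀ a₁ (Efl F) (logz F)) k (prefixOf gs k) - b k| ≤ r) ∧
        (∀ (n : ℕ) (gs : ℕ → ℝ), RGEqH n (betaOfRecord₁₃ F 2 (theta13OfThm1CCMWZ F 2 j γ ε₀ ε₂₉ B₃ B₃' a₀ a₁ (Efl F) (logz F))) gs → Step.InInterval γ₀ n gs → ∀ k, k ≤ n → -M ≤ ∑ j ∈ Finset.Ico k n, betaOfRecord₁₃ F 2 (theta13OfThm1CCMWZ F 2 j γ ε₀ ε₂₉ B₃ B₃' a₀ a₁ (Efl F) (logz F)) j (prefixOf gs j)) ∧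
        ∀ k : ℕ, ContinuousOn (fun x : ℝ => betaOfRecord₁₃ F 2 (theta13OfThm1CCMWZ F 2 j γ ε₀ ε₂₉ B₃ B₃' a₀ a₁ (Efl F) (logz F)) k (clampPrefix (betaOfRecord₁₃ F 2 (theta13OfThm1CCMWZ F 2 j γ ε₀ ε₂₉ B₃ B₃' a₀ a₁ (Efl F) (logz F))) γ₀ k x))
          {x : ℝ | 0 < x ∧ x ≤ γ₀ ∧ ∀ j', j' ≤ k → 1 / γ₀ ^ 2 ≤ Y (betaOfRecord₁₃ F 2 (theta13OfThm1CCMWZ F 2 j γ ε₀ ε₂₉ B₃ B₃' a₀ a₁ (Efl F) (logz F))) γ₀ j' x}) :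
    Summit.QuantumFields.YangMills.Theses.BalabanUVNodes.StabilityBRunRowsAtRecordR13SepCoPHV := by
  refine N24_stabilityBRunRowsAtRecordR13SepCoPHV_byName_of_openStubsGridG_of_childrenSplitPerKappaPrimeGuardedThm1AE_atGaussPinZ_of_runRowsCont M₁ R Efl logz h1G3 h3A'G3 (fun F {j} {γ} {ε₀} {ε₂₉} {B₃} {B₃'} {a₀} {a₁} hγ₀ hγh hε hε' hB hB' ha₀ ha₁ {bl} {β'} hbox hbox' hl hβ' => ?_) h06 h07 h08 h09 h09T h10 h11N h13 hrowsR
  haveI : FiniteDimensional ℝ (theta13OfThm1CCMWZ F 2 j γ ε₀ ε₂₉ B₃ B₃' a₀ a₁ (Efl F) (logz F)).toStage3Params.𝔸 :=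
    -- RE-KEY-NEUTRAL (director-ym №262, FLAG №14 T0 (β)): the by-name lemma of `Node00/Record12NumericsFamilyFiniteDim` (p692370), any `(stage3OfFamily F).𝔸`.
    Literature.MathematicalPhysics.QuantumFieldTheory.Balaban1983to89.Node00.finiteDimensional_𝔸_stage3OfFamily F
  obtain ⟨τ, Cτ, ops₀, M, aI, aT, aS, B₀N, Cβ, cS, cSβ, β, len, B₀'H, B₂', BG, BR, cL, hτp, hτt, hτs, hCτ, hM1, haI, haT, haS, hB₀N, hCβ, hcS, hcSβ,
    hB₀'H, hB₂', hBG, hBR, hcL, hinv, hglob, hhol, hsrc, hsrcH, hLet, SLetUB⟩ := hN05 F hγ₀ hγh hε hε' hB hB' ha₀ ha₁ hbox hbox' hl hβ'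
  exact exists_residB8_slot8κ'_of_bindersLettersPer_doorL (theta13OfThm1CCMWZ F 2 j γ ε₀ ε₂₉ B₃ B₃' a₀ a₁ (Efl F) (logz F)).toStage3Params (by show 2 ≤ 4; norm_num) (by have := F.hL11; show 5 ≤ F.L; omega) M₁ R hM₁
    τ hτp hτt hτs hCτ ops₀ hM1 haI haT haS hB₀N hCβ hcS hcSβ hB₀'H hB₂' hBG hBR hcL hinv hglob hhol hsrc hsrcH hLet SLetUB

end Summit.QuantumFields.YangMills.BalabanUVNodes.N24K1FaceN05JunctionLSlot8KappaPrimeAtGaussPinZ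

end
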